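import Mathlib.Probability.Distributions.Cauchy
import Mathlib.MeasureTheory.Function.JacobianOneDim
import Mathlib.Analysis.SpecialFunctions.Log.Basic
import Mathlib.Analysis.SpecialFunctions.Sqrt
import Mathlib.Analysis.SpecialFunctions.Trigonometric.Bounds
import Mathlib.MeasureTheory.Integral.Prod
import Literature.Probability.RandomMatrixProducts.AndersonModel1DSmoothing
import HarnessLib

/-!
# Positivity of the Lyapunov exponent of the one-dimensional Anderson model for absolutely continuous single-site laws — a quantitative Fürstenberg theorem

Main result (`andersonLyapunov_pos_of_density`): if the single-site law `μ` of the Anderson /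
discrete Schrödinger cocycle `M^E(α) = [[E - α, -1],[1, 0]]` satisfies `μ[p,q] ≤ K (q - p)` for all
`p ≤ q` (a bounded density) and has bounded support, then for EVERY energy `E`
`L(E) = inf_n n⁻¹ 𝔼 log ‖M_n^E‖ ≥ (3/(8(64(2K+1)K+1)))²/16 > 0`.
This is the conclusion of Fürstenberg's theorem (Furstenberg 1963, Thm 8.6; for the Anderson model
Bucaj–Damanik–Fillman–Gerbuz–VandenBoom–Wang–Zhang, TAMS 372 (2019), Thm 2.3) in the absolutely
continuous case, with an explicit bound depending on the density bound only; it is the input the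
disordered harmonic chain needs (`Literature/Barriers/AtomisticToContinuum/`, the laws of the
potentials `ω² m_k` having `C¹` densities).

## The proof (Fürstenberg's entropy argument, made quantitative and finite)

Work in the chart `s = x₂/x₁` of the projective line with the Cauchy law `m` as reference measure
(`ProbabilityTheory.cauchyMeasure 0 1`). The matrix `A(a) = [[a,-1],[1,0]]` acts by the Möbius step
`s ↦ 1/(a - s)` (`mobStep`) and `‖A(a) x_s‖² = J_a(s) = ((a-s)²+1)/(1+s²)` for the unit vector
`x_s ∥ (1,s)` (`stepJac`). If `s ∼ φ·m` then `1/(a-s) ∼ (P_aφ)·m` with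
`P_aφ(y) = φ(a - 1/y) w_a(y)`, `w_a(y) = (1+y²)/(y²+(ay-1)²)` (`pushDensity`; the change of variables
`integral_mobStep_cauchy` is Mathlib's one-dimensional Jacobian formula for `y ↦ a - 1/y`), and the
key identity `P_aφ(1/(a-s)) = φ(s) J_a(s)` holds (`pushDensity_mobStep`). Averaging over the site law
gives the transfer operator `P` (`transferOp`) and the iterated densities `φ_k = P^k 1`
(`iterDensity`), the laws of the slope of `M_k^E (1,s)ᵀ`, `s ∼ m` (`integral_integral_slope_chainVec`).

* Entropy production (`entropy_step`): with `H(ψ) = ∫ ψ log ψ dm` and `2I(φ) = ∫∫ log J_{E-α}(s) φ(s) dm dμ`,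
  `H(Pφ) - H(φ) + ∫∫ (√(P_{E-α}φ) - √(Pφ))² dm dμ ≤ 2I(φ)` — Jensen for `t log t` across the site
  law, sharpened by the Bregman–Hellinger inequality `t log t - u log u - (1 + log u)(t-u) ≥ (√t-√u)²`.
* Uniform non-invariance (`hellinger_variance_lower`): two push-forwards `A(a)λ`, `A(a')λ` differ by
  the translation `s ↦ s + (a - a')` (`integral_indicator_pushDensity`); a probability density with
  tails `∫ 1_{|s|>L} φ ≤ C/L` cannot be almost translation invariant (distribution-function
  telescoping, `hellinger_pair_lower`), and pairs of sites with `|α - α'| ≥ 1/(4K)` have probability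
  `≥ 1/2`; hence the Hellinger variance is `≥ r = (3/(8(64CK+1)))²/8`, `C = 2K+1`, uniformly in `k`
  (tails of `φ_k`: `integral_indicator_tail_iterDensity_le`).
* Summation and the cocycle (`integral_log_norm_chainVec`, `andersonLogNormAvg_ge`):
  `𝔼 log ‖M_n‖ ≥ 𝔼 ∫ (log ‖M_n x_s‖ - log ‖x_s‖) dm(s) = ½ Σ_{k<n} 2I(φ_k) ≥ ½ (H(φ_n) - H(1) + n r) ≥ n r/2`.

Everything is proved; there are no named facts in this file. Not here: singular (e.g. Bernoulli)
site laws — the genuine Fürstenberg theorem `BucajEtAl2019_lyapunovPos` of `AndersonModel1D.lean`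
stays a named fact — and continuity or large deviations of `L`.

References: H. Furstenberg, *Noncommuting random products*, Trans. AMS 108 (1963) 377–428;
P. Bougerol, J. Lacroix, *Products of Random Matrices with Applications to Schrödinger Operators*,
Birkhäuser 1985, Part A Ch. II–III; Bucaj et al., TAMS 372 (2019) 3619–3667, §2.
-/

noncomputable section

open MeasureTheory ProbabilityTheory Set Filter
open scoped ENNReal NNReal Matrix.Norms.L2Operator

namespace Literature.Probability.RandomMatrixProducts

/-! ### The Cauchy reference measure -/

/-- The Cauchy density `π⁻¹ (1 + s²)⁻¹` in closed form. [folklore] -/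
theorem cauchyPDFReal_zero_one (s : ℝ) : cauchyPDFReal 0 1 s = Real.pi⁻¹ * (1 + s ^ 2)⁻¹ := by
  rw [cauchyPDFReal_def]; simp [add_comm]

/-- The Cauchy density is positive. [folklore] -/
theorem cauchyPDFReal_zero_one_pos (s : ℝ) : 0 < cauchyPDFReal 0 1 s :=
  cauchyPDF_pos 0 one_ne_zero s

/-- `cauchyMeasure 0 1 = (π⁻¹(1+s²)⁻¹) · Lebesgue`. [folklore] -/
theorem cauchyMeasure_zero_one_eq :
    cauchyMeasure 0 1 = volume.withDensity fun s => ENNReal.ofReal (cauchyPDFReal 0 1 s) :=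
  cauchyMeasure_of_scale_ne_zero 0 one_ne_zero

/-- Integration against the Cauchy reference measure is integration against its density.
[folklore] -/
theorem integral_cauchyMeasure (F : ℝ → ℝ) :
    ∫ s, F s ∂(cauchyMeasure 0 1) = ∫ s, F s * cauchyPDFReal 0 1 s := by
  rw [cauchyMeasure_zero_one_eq, integral_withDensity_eq_integral_toReal_smul
    ((measurable_cauchyPDFReal 0 1).ennreal_ofReal) (Eventually.of_forall fun _ => ENNReal.ofReal_lt_top)]
  refine integral_congr_ae (Eventually.of_forall fun s => ?_)
  simp only [smul_eq_mul]
  rw [ENNReal.toReal_ofReal (cauchyPDFReal_zero_one_pos s).le, mul_comm]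

/-- Lower integration against the Cauchy reference measure. [folklore] -/
theorem lintegral_cauchyMeasure (F : ℝ → ℝ≥0∞) (hF : Measurable F) :
    ∫⁻ s, F s ∂(cauchyMeasure 0 1) = ∫⁻ s, ENNReal.ofReal (cauchyPDFReal 0 1 s) * F s := by
  rw [cauchyMeasure_zero_one_eq, lintegral_withDensity_eq_lintegral_mul _
    ((measurable_cauchyPDFReal 0 1).ennreal_ofReal) hF]
  rfl

/-! ### The projective action of a transfer matrix in the chart `s = x₂/x₁` -/

/-- The Möbius step `s ↦ 1/(a - s)`: the action of `[[a,-1],[1,0]]` on the slope `s = x₂/x₁`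
(`(x₁, x₂) ↦ (a x₁ - x₂, x₁)`). [folklore] -/
def mobStep (a s : ℝ) : ℝ := (a - s)⁻¹

/-- The norm cocycle `J_a(s) = ‖[[a,-1],[1,0]] x_s‖²` for the unit vector `x_s ∥ (1, s)`:
`((a - s)² + 1)/(1 + s²)`. [folklore] -/
def stepJac (a s : ℝ) : ℝ := ((a - s) ^ 2 + 1) / (1 + s ^ 2)

/-- The Radon–Nikodym weight of the Möbius step against the Cauchy measure:
`w_a(y) = (1 + y²)/(y² + (a y - 1)²) = 1/J_a(a - 1/y)`. [folklore] -/
def stepWeight (a y : ℝ) : ℝ := (1 + y ^ 2) / (y ^ 2 + (a * y - 1) ^ 2)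

/-- The push-forward of a density: if `s ∼ φ · Cauchy` then `1/(a - s) ∼ (pushDensity a φ) · Cauchy`,
`pushDensity a φ (y) = φ(a - 1/y) w_a(y)`. [folklore] -/
def pushDensity (a : ℝ) (φ : ℝ → ℝ) (y : ℝ) : ℝ := φ (a - y⁻¹) * stepWeight a y

/-- The denominator of `w_a` is positive. [folklore] -/
theorem stepWeight_den_pos (a y : ℝ) : 0 < y ^ 2 + (a * y - 1) ^ 2 := by
  rcases eq_or_ne y 0 with rfl | hy
  · norm_num
  · positivity

/-- `w_a > 0`. [folklore] -/
theorem stepWeight_pos (a y : ℝ) : 0 < stepWeight a y :=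
  div_pos (by positivity) (stepWeight_den_pos a y)

/-- `w_a(y) ≤ a² + 2` (Cauchy–Schwarz: `1 = (a·y - (ay-1))² ≤ (a²+1)(y² + (ay-1)²)`). [folklore] -/
theorem stepWeight_le (a y : ℝ) : stepWeight a y ≤ a ^ 2 + 2 := by
  unfold stepWeight
  rw [div_le_iff₀ (stepWeight_den_pos a y)]
  nlinarith [sq_nonneg (a * (a * y - 1) + y), sq_nonneg y, sq_nonneg (a * y - 1), sq_nonneg a]

/-- `J_a > 0`. [folklore] -/
theorem stepJac_pos (a s : ℝ) : 0 < stepJac a s := by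
  unfold stepJac; positivity

/-- `J_a(s) ≤ a² + 2`. [folklore] -/
theorem stepJac_le (a s : ℝ) : stepJac a s ≤ a ^ 2 + 2 := by
  unfold stepJac
  rw [div_le_iff₀ (by positivity)]
  nlinarith [sq_nonneg (a * s + 1), sq_nonneg s, sq_nonneg (a - s), sq_nonneg a]

/-- `1/(a² + 2) ≤ J_a(s)`. [folklore] -/
theorem inv_le_stepJac (a s : ℝ) : (a ^ 2 + 2)⁻¹ ≤ stepJac a s := by
  unfold stepJac
  rw [inv_eq_one_div, div_le_div_iff₀ (by positivity) (by positivity)]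
  nlinarith [sq_nonneg (a * (a - s) + 1), sq_nonneg s, sq_nonneg (a - s), sq_nonneg a]

/-- `|log J_a(s)| ≤ log (a² + 2)`. [folklore] -/
theorem abs_log_stepJac_le (a s : ℝ) : |Real.log (stepJac a s)| ≤ Real.log (a ^ 2 + 2) := by
  have h2 : (1 : ℝ) ≤ a ^ 2 + 2 := by nlinarith [sq_nonneg a]
  rw [abs_le]
  constructor
  · rw [← Real.log_inv]
    exact Real.log_le_log (by positivity) (inv_le_stepJac a s)
  · exact Real.log_le_log (stepJac_pos a s) (stepJac_le a s)

/-- **The key identity** `pushDensity a φ (1/(a-s)) = φ(s) J_a(s)` for `s ≠ a`. [folklore] -/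
theorem pushDensity_mobStep (a : ℝ) (φ : ℝ → ℝ) {s : ℝ} (hs : s ≠ a) :
    pushDensity a φ (mobStep a s) = φ s * stepJac a s := by
  have has : a - s ≠ 0 := sub_ne_zero.mpr (Ne.symm hs)
  unfold pushDensity mobStep stepWeight stepJac
  rw [inv_inv, sub_sub_cancel]
  congr 1
  rw [div_eq_div_iff (stepWeight_den_pos a _).ne' (by positivity)]
  field_simp
  ring

/-- `0 ≤ pushDensity a φ` when `0 ≤ φ`. [folklore] -/
theorem pushDensity_nonneg (a : ℝ) {φ : ℝ → ℝ} (hφ : ∀ s, 0 ≤ φ s) (y : ℝ) : 0 ≤ pushDensity a φ y :=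
  mul_nonneg (hφ _) (stepWeight_pos a y).le

/-- `0 < pushDensity a φ` when `0 < φ`. [folklore] -/
theorem pushDensity_pos (a : ℝ) {φ : ℝ → ℝ} (hφ : ∀ s, 0 < φ s) (y : ℝ) : 0 < pushDensity a φ y :=
  mul_pos (hφ _) (stepWeight_pos a y)

/-- `pushDensity a φ ≤ B (a² + 2)` when `0 ≤ φ ≤ B`. [folklore] -/
theorem pushDensity_le (a : ℝ) {φ : ℝ → ℝ} {B : ℝ} (hφ0 : ∀ s, 0 ≤ φ s) (hφ : ∀ s, φ s ≤ B) (y : ℝ) :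
    pushDensity a φ y ≤ B * (a ^ 2 + 2) :=
  mul_le_mul (hφ (a - y⁻¹)) (stepWeight_le a y) (stepWeight_pos a y).le
    ((hφ0 (a - y⁻¹)).trans (hφ (a - y⁻¹)))

/-- Measurability of `pushDensity`, jointly in `(a, y)`. [folklore] -/
theorem measurable_pushDensity_uncurry {φ : ℝ → ℝ} (hφ : Measurable φ) :
    Measurable fun p : ℝ × ℝ => pushDensity p.1 φ p.2 := by
  unfold pushDensity stepWeight
  refine Measurable.mul (hφ.comp (measurable_fst.sub measurable_snd.inv)) ?_
  exact Measurable.div (by fun_prop) (by fun_prop)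

/-- Measurability of `pushDensity a φ`. [folklore] -/
theorem measurable_pushDensity (a : ℝ) {φ : ℝ → ℝ} (hφ : Measurable φ) :
    Measurable (pushDensity a φ) :=
  (measurable_pushDensity_uncurry hφ).comp (measurable_const.prodMk measurable_id)

/-! ### Change of variables -/

/-- **The substitution `s = a - 1/y`** (Lebesgue measure, no hypotheses on `h`):
`∫ h(s) ds = ∫ h(a - 1/y) y⁻² dy`. [folklore] -/
theorem integral_comp_sub_inv (a : ℝ) (h : ℝ → ℝ) :
    ∫ s, h s = ∫ y, (y ^ 2)⁻¹ * h (a - y⁻¹) := by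
  have hS : MeasurableSet ({0}ᶜ : Set ℝ) := (measurableSet_singleton 0).compl
  have hderiv : ∀ y ∈ ({0}ᶜ : Set ℝ), HasDerivWithinAt (fun y : ℝ => a - y⁻¹) ((y ^ 2)⁻¹) ({0}ᶜ) y := by
    intro y hy
    have hy' : y ≠ 0 := hy
    have := ((hasDerivAt_inv hy').const_sub a)
    simp only [neg_neg] at this
    exact this.hasDerivWithinAt
  have hinj : InjOn (fun y : ℝ => a - y⁻¹) ({0}ᶜ) := by
    intro x _ y _ hxy
    simpa using hxy
  have himg : (fun y : ℝ => a - y⁻¹) '' ({0}ᶜ : Set ℝ) = {a}ᶜ := by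
    ext s
    simp only [mem_image, mem_compl_iff, mem_singleton_iff]
    constructor
    · rintro ⟨y, hy, rfl⟩
      simpa using hy
    · intro hs
      refine ⟨(a - s)⁻¹, inv_ne_zero (sub_ne_zero.mpr (Ne.symm hs)), ?_⟩
      rw [inv_inv, sub_sub_cancel]
  have key := integral_image_eq_integral_abs_deriv_smul hS hderiv hinj h
  rw [himg, restrict_compl_singleton, restrict_compl_singleton] at key
  rw [key]
  refine integral_congr_ae (Eventually.of_forall fun y => ?_)
  simp only [smul_eq_mul]
  rw [abs_of_nonneg (by positivity)]

/-- The substitution `s = a - 1/y` for lower integrals. [folklore] -/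
theorem lintegral_comp_sub_inv (a : ℝ) (h : ℝ → ℝ≥0∞) :
    ∫⁻ s, h s = ∫⁻ y, ENNReal.ofReal ((y ^ 2)⁻¹) * h (a - y⁻¹) := by
  have hS : MeasurableSet ({0}ᶜ : Set ℝ) := (measurableSet_singleton 0).compl
  have hderiv : ∀ y ∈ ({0}ᶜ : Set ℝ), HasDerivWithinAt (fun y : ℝ => a - y⁻¹) ((y ^ 2)⁻¹) ({0}ᶜ) y := by
    intro y hy
    have hy' : y ≠ 0 := hy
    have := ((hasDerivAt_inv hy').const_sub a)
    simp only [neg_neg] at this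
    exact this.hasDerivWithinAt
  have hinj : InjOn (fun y : ℝ => a - y⁻¹) ({0}ᶜ) := by
    intro x _ y _ hxy
    simpa using hxy
  have himg : (fun y : ℝ => a - y⁻¹) '' ({0}ᶜ : Set ℝ) = {a}ᶜ := by
    ext s
    simp only [mem_image, mem_compl_iff, mem_singleton_iff]
    constructor
    · rintro ⟨y, hy, rfl⟩
      simpa using hy
    · intro hs
      refine ⟨(a - s)⁻¹, inv_ne_zero (sub_ne_zero.mpr (Ne.symm hs)), ?_⟩
      rw [inv_inv, sub_sub_cancel]
  have key := lintegral_image_eq_lintegral_abs_deriv_mul hS hderiv hinj h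
  rw [himg, restrict_compl_singleton, restrict_compl_singleton] at key
  rw [key]
  refine lintegral_congr_ae (Eventually.of_forall fun y => ?_)
  dsimp only
  rw [abs_of_nonneg (by positivity)]

/-- The Jacobian identity behind the transfer operator: `y⁻² c(a - 1/y) = w_a(y) c(y)` for `y ≠ 0`,
`c` the Cauchy density. [folklore] -/
theorem inv_sq_mul_cauchy (a : ℝ) {y : ℝ} (hy : y ≠ 0) :
    (y ^ 2)⁻¹ * cauchyPDFReal 0 1 (a - y⁻¹) = stepWeight a y * cauchyPDFReal 0 1 y := by
  rw [cauchyPDFReal_zero_one, cauchyPDFReal_zero_one]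
  unfold stepWeight
  have hden := stepWeight_den_pos a y
  field_simp

/-- **Change of variables for the Möbius step against the Cauchy measure** (no hypotheses on
`g, φ`): `∫ g(1/(a-s)) φ(s) dm(s) = ∫ g(y) (pushDensity a φ)(y) dm(y)`. [folklore] -/
theorem integral_mobStep_cauchy (a : ℝ) (g φ : ℝ → ℝ) :
    ∫ s, g (mobStep a s) * φ s ∂(cauchyMeasure 0 1) = ∫ y, g y * pushDensity a φ y ∂(cauchyMeasure 0 1) := by
  rw [integral_cauchyMeasure, integral_cauchyMeasure,
    integral_comp_sub_inv a fun s => g (mobStep a s) * φ s * cauchyPDFReal 0 1 s]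
  refine integral_congr_ae ?_
  have hae : ∀ᵐ y : ℝ ∂volume, y ≠ 0 := Measure.ae_ne volume 0
  filter_upwards [hae] with y hy
  unfold mobStep pushDensity
  rw [sub_sub_cancel, inv_inv]
  have := inv_sq_mul_cauchy a hy
  calc (y ^ 2)⁻¹ * (g y * φ (a - y⁻¹) * cauchyPDFReal 0 1 (a - y⁻¹))
      = g y * φ (a - y⁻¹) * ((y ^ 2)⁻¹ * cauchyPDFReal 0 1 (a - y⁻¹)) := by ring
    _ = g y * (φ (a - y⁻¹) * stepWeight a y) * cauchyPDFReal 0 1 y := by rw [this]; ring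

/-- Lower-integral form of the change of variables. [folklore] -/
theorem lintegral_mobStep_cauchy (a : ℝ) (G : ℝ → ℝ≥0∞) (hG : Measurable G) {φ : ℝ → ℝ}
    (hφ : Measurable φ) (hφ0 : ∀ s, 0 ≤ φ s) :
    ∫⁻ s, G (mobStep a s) * ENNReal.ofReal (φ s) ∂(cauchyMeasure 0 1) =
      ∫⁻ y, G y * ENNReal.ofReal (pushDensity a φ y) ∂(cauchyMeasure 0 1) := by
  have hmob : Measurable (mobStep a) := by unfold mobStep; fun_prop
  have h1 : ∫⁻ s, G (mobStep a s) * ENNReal.ofReal (φ s) ∂(cauchyMeasure 0 1) =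
      ∫⁻ s, ENNReal.ofReal (cauchyPDFReal 0 1 s) * (G (mobStep a s) * ENNReal.ofReal (φ s)) :=
    lintegral_cauchyMeasure (fun s => G (mobStep a s) * ENNReal.ofReal (φ s))
      ((hG.comp hmob).mul hφ.ennreal_ofReal)
  have h2 : ∫⁻ y, G y * ENNReal.ofReal (pushDensity a φ y) ∂(cauchyMeasure 0 1) =
      ∫⁻ y, ENNReal.ofReal (cauchyPDFReal 0 1 y) * (G y * ENNReal.ofReal (pushDensity a φ y)) :=
    lintegral_cauchyMeasure (fun y => G y * ENNReal.ofReal (pushDensity a φ y))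
      (hG.mul (measurable_pushDensity a hφ).ennreal_ofReal)
  rw [h1, h2, lintegral_comp_sub_inv a]
  refine lintegral_congr_ae ?_
  have hae : ∀ᵐ y : ℝ ∂volume, y ≠ 0 := Measure.ae_ne volume 0
  filter_upwards [hae] with y hy
  unfold mobStep pushDensity
  rw [sub_sub_cancel, inv_inv]
  have hw := (stepWeight_pos a y).le
  have key : ENNReal.ofReal ((y ^ 2)⁻¹) * ENNReal.ofReal (cauchyPDFReal 0 1 (a - y⁻¹)) =
      ENNReal.ofReal (stepWeight a y) * ENNReal.ofReal (cauchyPDFReal 0 1 y) := by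
    rw [← ENNReal.ofReal_mul (by positivity), inv_sq_mul_cauchy a hy, ENNReal.ofReal_mul hw]
  rw [ENNReal.ofReal_mul (hφ0 _)]
  calc ENNReal.ofReal ((y ^ 2)⁻¹) * (ENNReal.ofReal (cauchyPDFReal 0 1 (a - y⁻¹)) *
        (G y * ENNReal.ofReal (φ (a - y⁻¹))))
      = ENNReal.ofReal ((y ^ 2)⁻¹) * ENNReal.ofReal (cauchyPDFReal 0 1 (a - y⁻¹)) *
        (G y * ENNReal.ofReal (φ (a - y⁻¹))) := by ring
    _ = ENNReal.ofReal (stepWeight a y) * ENNReal.ofReal (cauchyPDFReal 0 1 y) *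
        (G y * ENNReal.ofReal (φ (a - y⁻¹))) := by rw [key]
    _ = ENNReal.ofReal (cauchyPDFReal 0 1 y) *
        (G y * (ENNReal.ofReal (φ (a - y⁻¹)) * ENNReal.ofReal (stepWeight a y))) := by ring

/-- Mass conservation: `∫ pushDensity a φ dm = ∫ φ dm`. [folklore] -/
theorem integral_pushDensity (a : ℝ) (φ : ℝ → ℝ) :
    ∫ y, pushDensity a φ y ∂(cauchyMeasure 0 1) = ∫ s, φ s ∂(cauchyMeasure 0 1) := by
  have h := integral_mobStep_cauchy a (fun _ => 1) φ
  simp only [one_mul] at h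
  exact h.symm
/-! ### Elementary inequalities for `t log t` -/

/-- `t - 1 ≤ t log t` for `t ≥ 0`. [folklore] -/
theorem sub_one_le_mul_log {t : ℝ} (ht : 0 ≤ t) : t - 1 ≤ t * Real.log t := by
  have h := Real.negMulLog_le_one_sub_self ht
  rw [Real.negMulLog] at h
  linarith

/-- `|t log t| ≤ B log B + 1` for `0 < t ≤ B`, `1 ≤ B`. [folklore] -/
theorem abs_mul_log_le {t B : ℝ} (ht : 0 < t) (htB : t ≤ B) (hB : 1 ≤ B) :
    |t * Real.log t| ≤ B * Real.log B + 1 := by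
  have hlogB : 0 ≤ Real.log B := Real.log_nonneg hB
  rw [abs_le]
  constructor
  · have := sub_one_le_mul_log ht.le
    nlinarith
  · have h1 : t * Real.log t ≤ t * Real.log B :=
      mul_le_mul_of_nonneg_left (Real.log_le_log ht htB) ht.le
    nlinarith

/-- **The Bregman–Hellinger inequality for `t log t`**: for `t, u > 0`,
`(√t - √u)² ≤ t log t - u log u - (1 + log u)(t - u)` (equivalently `log v ≥ 1 - 1/v` at
`v = √(t/u)`). [folklore] -/
theorem sq_sqrt_sub_sqrt_le_bregman {t u : ℝ} (ht : 0 < t) (hu : 0 < u) :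
    (Real.sqrt t - Real.sqrt u) ^ 2 ≤
      t * Real.log t - u * Real.log u - (1 + Real.log u) * (t - u) := by
  set st := Real.sqrt t with hst
  set su := Real.sqrt u with hsu
  have hst0 : 0 < st := Real.sqrt_pos.mpr ht
  have hsu0 : 0 < su := Real.sqrt_pos.mpr hu
  have ht2 : t = st ^ 2 := (Real.sq_sqrt ht.le).symm
  have hu2 : u = su ^ 2 := (Real.sq_sqrt hu.le).symm
  rw [ht2, hu2, Real.log_pow, Real.log_pow]
  have h1 : 1 - su / st ≤ Real.log st - Real.log su := by
    have := Real.one_sub_inv_le_log_of_pos (x := st / su) (by positivity)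
    rwa [inv_div, Real.log_div hst0.ne' hsu0.ne'] at this
  have key : 2 * st ^ 2 - 2 * st * su ≤ 2 * st ^ 2 * (Real.log st - Real.log su) := by
    have h2 := mul_le_mul_of_nonneg_left h1 (by positivity : (0 : ℝ) ≤ 2 * st ^ 2)
    have h3 : 2 * st ^ 2 * (1 - su / st) = 2 * st ^ 2 - 2 * st * su := by
      field_simp
    linarith
  push_cast
  nlinarith [key]

/-! ### The averaged transfer operator and its iterates -/

/-- **The transfer operator on densities**: `Pφ(y) = ∫ pushDensity (E - α) φ (y) dμ(α)`, the density
(against the Cauchy measure) of the law of the slope after one random step `s ↦ 1/(E - α - s)`,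
`α ∼ μ`, when `s ∼ φ · Cauchy`. [folklore] -/
def transferOp (μ : Measure ℝ) (E : ℝ) (φ : ℝ → ℝ) (y : ℝ) : ℝ := ∫ α, pushDensity (E - α) φ y ∂μ

/-- **The iterated densities** `φ_k = P^k 1`: the law of the slope `x₂/x₁` of `M_k^E x` for a
uniformly distributed initial direction, as a density against the Cauchy measure. [folklore] -/
def iterDensity (μ : Measure ℝ) (E : ℝ) : ℕ → ℝ → ℝ
  | 0 => fun _ => 1
  | k + 1 => transferOp μ E (iterDensity μ E k)

section TransferOp

variable {μ : Measure ℝ} {E D : ℝ}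

/-- Joint measurability of `(α, y) ↦ pushDensity (E - α) φ y`. [folklore] -/
theorem measurable_pushDensity_sub {φ : ℝ → ℝ} (hφ : Measurable φ) (E : ℝ) :
    Measurable fun p : ℝ × ℝ => pushDensity (E - p.1) φ p.2 :=
  (measurable_pushDensity_uncurry hφ).comp ((measurable_const.sub measurable_fst).prodMk measurable_snd)

/-- `Pφ` is measurable. [folklore] -/
theorem measurable_transferOp [SFinite μ] {φ : ℝ → ℝ} (hφ : Measurable φ) :
    Measurable (transferOp μ E φ) :=
  ((measurable_pushDensity_sub hφ E).stronglyMeasurable.integral_prod_left' (μ := μ)).measurable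

/-- The a.e. bound `(E - α)² + 2 ≤ D` from `|α| ≤ R` a.e., with `D = (|E| + R)² + 2`. [folklore] -/
theorem ae_sq_add_two_le {R : ℝ} (hR : ∀ᵐ x ∂μ, |x| ≤ R) (E : ℝ) :
    ∀ᵐ α ∂μ, (E - α) ^ 2 + 2 ≤ (|E| + R) ^ 2 + 2 := by
  filter_upwards [hR] with α hα
  have h1 : |E - α| ≤ |E| + R := (abs_sub _ _).trans (by linarith)
  have h2 : (E - α) ^ 2 ≤ (|E| + R) ^ 2 := by
    rw [← sq_abs (E - α)]
    exact pow_le_pow_left₀ (abs_nonneg _) h1 2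
  linarith

/-- The integrand of `Pφ(y)` is bounded a.e.: `pushDensity (E-α) φ y ≤ B D`. [folklore] -/
theorem ae_pushDensity_le (hD : ∀ᵐ α ∂μ, (E - α) ^ 2 + 2 ≤ D) {φ : ℝ → ℝ} {B : ℝ}
    (hφ0 : ∀ s, 0 ≤ φ s) (hφB : ∀ s, φ s ≤ B) (y : ℝ) :
    ∀ᵐ α ∂μ, pushDensity (E - α) φ y ≤ B * D := by
  have hB : 0 ≤ B := (hφ0 0).trans (hφB 0)
  filter_upwards [hD] with α hα
  exact (pushDensity_le (E - α) hφ0 hφB y).trans (mul_le_mul_of_nonneg_left hα hB)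

/-- Integrability of `α ↦ pushDensity (E-α) φ y`. [folklore] -/
theorem integrable_pushDensity [IsFiniteMeasure μ] (hD : ∀ᵐ α ∂μ, (E - α) ^ 2 + 2 ≤ D) {φ : ℝ → ℝ} {B : ℝ}
    (hφ : Measurable φ) (hφ0 : ∀ s, 0 ≤ φ s) (hφB : ∀ s, φ s ≤ B) (y : ℝ) :
    Integrable (fun α => pushDensity (E - α) φ y) μ := by
  refine Integrable.of_bound ((measurable_pushDensity_sub hφ E).comp
    (measurable_id.prodMk measurable_const)).aestronglyMeasurable (B * D) ?_
  filter_upwards [ae_pushDensity_le hD hφ0 hφB y] with α hα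
  rw [Real.norm_eq_abs, abs_of_nonneg (pushDensity_nonneg _ hφ0 _)]
  exact hα

/-- `0 < Pφ` when `0 < φ`. [folklore] -/
theorem transferOp_pos [IsProbabilityMeasure μ] (hD : ∀ᵐ α ∂μ, (E - α) ^ 2 + 2 ≤ D) {φ : ℝ → ℝ} {B : ℝ}
    (hφ : Measurable φ) (hφ0 : ∀ s, 0 < φ s) (hφB : ∀ s, φ s ≤ B) (y : ℝ) :
    0 < transferOp μ E φ y := by
  unfold transferOp
  rw [integral_pos_iff_support_of_nonneg (fun α => (pushDensity_pos _ hφ0 y).le)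
    (integrable_pushDensity hD hφ (fun s => (hφ0 s).le) hφB y)]
  have : Function.support (fun α => pushDensity (E - α) φ y) = Set.univ :=
    Set.eq_univ_iff_forall.mpr fun α => Function.mem_support.mpr (pushDensity_pos _ hφ0 y).ne'
  rw [this, measure_univ]
  exact one_pos

/-- `0 ≤ Pφ` when `0 ≤ φ`. [folklore] -/
theorem transferOp_nonneg {φ : ℝ → ℝ} (hφ0 : ∀ s, 0 ≤ φ s) (y : ℝ) : 0 ≤ transferOp μ E φ y :=
  integral_nonneg fun _ => pushDensity_nonneg _ hφ0 y

/-- `Pφ ≤ B D` when `φ ≤ B`. [folklore] -/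
theorem transferOp_le [IsProbabilityMeasure μ] (hD : ∀ᵐ α ∂μ, (E - α) ^ 2 + 2 ≤ D) {φ : ℝ → ℝ} {B : ℝ}
    (hφ0 : ∀ s, 0 ≤ φ s) (hφB : ∀ s, φ s ≤ B) (y : ℝ) :
    transferOp μ E φ y ≤ B * D := by
  unfold transferOp
  have h := integral_mono_of_nonneg (μ := μ) (Eventually.of_forall fun α => pushDensity_nonneg (E - α) hφ0 y)
    (integrable_const (B * D)) (ae_pushDensity_le hD hφ0 hφB y)
  simpa using h

end TransferOp
section Entropy

variable {μ : Measure ℝ} {E D B : ℝ} {φ : ℝ → ℝ}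

/-- Singletons are null for the Cauchy measure. [folklore] -/
theorem ae_cauchy_ne (a : ℝ) : ∀ᵐ s ∂(cauchyMeasure 0 1), s ≠ a := by
  rw [cauchyMeasure_zero_one_eq]
  exact (withDensity_absolutelyContinuous _ _).ae_le (Measure.ae_ne volume a)

/-- A bounded measurable function is integrable against the Cauchy measure. [folklore] -/
theorem integrable_cauchy_of_bound {f : ℝ → ℝ} (hf : Measurable f) (C : ℝ) (hC : ∀ s, |f s| ≤ C) :
    Integrable f (cauchyMeasure 0 1) :=
  Integrable.of_bound hf.aestronglyMeasurable C (Eventually.of_forall fun s => by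
    rw [Real.norm_eq_abs]; exact hC s)

/-- `stepJac` is measurable in both variables. [folklore] -/
theorem measurable_stepJac_uncurry : Measurable fun p : ℝ × ℝ => stepJac p.1 p.2 := by
  unfold stepJac; fun_prop

/-- **The per-step entropy identity**: for `0 < φ ≤ B` and any `a`,
`∫ (P_aφ) log (P_aφ) dm = ∫ φ log φ dm + ∫ log J_a · φ dm` (change of variables plus
`P_aφ(1/(a-s)) = φ(s) J_a(s)`). [folklore] -/
theorem integral_pushDensity_mul_log (a : ℝ) (hφ : Measurable φ) (hφ0 : ∀ s, 0 < φ s)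
    (hφB : ∀ s, φ s ≤ B) (hB : 1 ≤ B) :
    ∫ y, pushDensity a φ y * Real.log (pushDensity a φ y) ∂(cauchyMeasure 0 1) =
      ∫ s, φ s * Real.log (φ s) ∂(cauchyMeasure 0 1) +
        ∫ s, Real.log (stepJac a s) * φ s ∂(cauchyMeasure 0 1) := by
  have h := integral_mobStep_cauchy a (fun y => Real.log (pushDensity a φ y)) φ
  have hcomm : ∫ y, pushDensity a φ y * Real.log (pushDensity a φ y) ∂(cauchyMeasure 0 1) =
      ∫ y, Real.log (pushDensity a φ y) * pushDensity a φ y ∂(cauchyMeasure 0 1) :=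
    integral_congr_ae (Eventually.of_forall fun y => mul_comm _ _)
  rw [hcomm, ← h]
  have hi1 : Integrable (fun s => φ s * Real.log (φ s)) (cauchyMeasure 0 1) :=
    integrable_cauchy_of_bound (hφ.mul hφ.log) (B * Real.log B + 1)
      fun s => abs_mul_log_le (hφ0 s) (hφB s) hB
  have hi2 : Integrable (fun s => Real.log (stepJac a s) * φ s) (cauchyMeasure 0 1) := by
    refine integrable_cauchy_of_bound ((measurable_stepJac_uncurry.comp
      (measurable_const.prodMk measurable_id)).log.mul hφ) (Real.log (a ^ 2 + 2) * B) fun s => ?_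
    rw [abs_mul, abs_of_pos (hφ0 s)]
    exact mul_le_mul (abs_log_stepJac_le a s) (hφB s) (hφ0 s).le
      (Real.log_nonneg (by nlinarith [sq_nonneg a]))
  rw [← integral_add hi1 hi2]
  refine integral_congr_ae ?_
  filter_upwards [ae_cauchy_ne a] with s hs
  rw [pushDensity_mobStep a φ hs, Real.log_mul (hφ0 s).ne' (stepJac_pos a s).ne']
  ring

/-- **Bregman integrated**: for a positive, a.e.-bounded `t` on a probability space with mean `u`,
`∫ (√t - √u)² ≤ ∫ t log t - u log u`. [folklore] -/
theorem integral_sq_sqrt_sub_le [IsProbabilityMeasure μ] {t : ℝ → ℝ} {C : ℝ} (htm : Measurable t)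
    (ht0 : ∀ α, 0 < t α) (htC : ∀ᵐ α ∂μ, t α ≤ C) :
    ∫ α, (Real.sqrt (t α) - Real.sqrt (∫ β, t β ∂μ)) ^ 2 ∂μ ≤
      ∫ α, t α * Real.log (t α) ∂μ - (∫ β, t β ∂μ) * Real.log (∫ β, t β ∂μ) := by
  set u := ∫ β, t β ∂μ with hu_def
  have hti : Integrable t μ := Integrable.of_bound htm.aestronglyMeasurable C
    (htC.mono fun α hα => by rw [Real.norm_eq_abs, abs_of_pos (ht0 α)]; exact hα)
  have hu : 0 < u := by
    rw [hu_def, integral_pos_iff_support_of_nonneg (fun α => (ht0 α).le) hti]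
    have : Function.support t = Set.univ :=
      Set.eq_univ_iff_forall.mpr fun α => Function.mem_support.mpr (ht0 α).ne'
    rw [this, measure_univ]; exact one_pos
  set C' := max C 1 with hC'
  have hC'1 : 1 ≤ C' := le_max_right _ _
  have htlog : Integrable (fun α => t α * Real.log (t α)) μ := by
    refine Integrable.of_bound (htm.mul htm.log).aestronglyMeasurable (C' * Real.log C' + 1) ?_
    filter_upwards [htC] with α hα
    rw [Real.norm_eq_abs]
    exact abs_mul_log_le (ht0 α) (hα.trans (le_max_left _ _)) hC'1
  have hlhs : Integrable (fun α => (Real.sqrt (t α) - Real.sqrt u) ^ 2) μ := by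
    refine Integrable.of_bound ((htm.sqrt.sub measurable_const).pow_const 2).aestronglyMeasurable
      (C + u) ?_
    filter_upwards [htC] with α hα
    rw [Real.norm_eq_abs, abs_of_nonneg (sq_nonneg _), sub_sq, Real.sq_sqrt (ht0 α).le,
      Real.sq_sqrt hu.le]
    nlinarith [Real.sqrt_nonneg (t α), Real.sqrt_nonneg u,
      mul_nonneg (Real.sqrt_nonneg (t α)) (Real.sqrt_nonneg u)]
  have hrhs : Integrable (fun α => t α * Real.log (t α) - u * Real.log u -
      (1 + Real.log u) * (t α - u)) μ :=
    (htlog.sub (integrable_const _)).sub ((hti.sub (integrable_const _)).const_mul _)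
  have e1 : ∫ α, (t α * Real.log (t α) - u * Real.log u - (1 + Real.log u) * (t α - u)) ∂μ =
      (∫ α, (t α * Real.log (t α) - u * Real.log u) ∂μ) - ∫ α, (1 + Real.log u) * (t α - u) ∂μ :=
    integral_sub (htlog.sub (integrable_const _)) ((hti.sub (integrable_const _)).const_mul _)
  have e2 : ∫ α, (t α * Real.log (t α) - u * Real.log u) ∂μ =
      (∫ α, t α * Real.log (t α) ∂μ) - ∫ _α, u * Real.log u ∂μ := integral_sub htlog (integrable_const _)
  have e3 : ∫ α, (1 + Real.log u) * (t α - u) ∂μ = (1 + Real.log u) * ∫ α, (t α - u) ∂μ :=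
    integral_const_mul _ _
  have e4 : ∫ α, (t α - u) ∂μ = (∫ α, t α ∂μ) - ∫ _α, u ∂μ := integral_sub hti (integrable_const _)
  have e5 : ∫ _α, u ∂μ = u := by simp
  have e6 : ∫ _α, u * Real.log u ∂μ = u * Real.log u := by simp
  calc ∫ α, (Real.sqrt (t α) - Real.sqrt u) ^ 2 ∂μ
      ≤ ∫ α, (t α * Real.log (t α) - u * Real.log u - (1 + Real.log u) * (t α - u)) ∂μ :=
        integral_mono hlhs hrhs fun α => sq_sqrt_sub_sqrt_le_bregman (ht0 α) hu
    _ = ∫ α, t α * Real.log (t α) ∂μ - u * Real.log u := by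
        rw [e1, e2, e3, e4, e5, e6, ← hu_def]; ring

end Entropy
section Step

variable {μ : Measure ℝ} {E D B : ℝ} {φ : ℝ → ℝ}

/-- Transport of the a.e. bound on the potentials to the product with the Cauchy measure. [folklore] -/
theorem ae_prod_sq_add_two_le (hD : ∀ᵐ α ∂μ, (E - α) ^ 2 + 2 ≤ D) :
    ∀ᵐ p ∂(μ.prod (cauchyMeasure 0 1)), (E - p.1) ^ 2 + 2 ≤ D :=
  (Measure.quasiMeasurePreserving_fst (μ := μ) (ν := cauchyMeasure 0 1)).ae hD

/-- Product integrability of `(α, y) ↦ pushDensity (E-α) φ y`. [folklore] -/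
theorem integrable_prod_pushDensity [IsProbabilityMeasure μ] (hD : ∀ᵐ α ∂μ, (E - α) ^ 2 + 2 ≤ D)
    (hφ : Measurable φ)
    (hφ0 : ∀ s, 0 ≤ φ s) (hφB : ∀ s, φ s ≤ B) :
    Integrable (fun p : ℝ × ℝ => pushDensity (E - p.1) φ p.2) (μ.prod (cauchyMeasure 0 1)) := by
  have hB : 0 ≤ B := (hφ0 0).trans (hφB 0)
  refine Integrable.of_bound (measurable_pushDensity_sub hφ E).aestronglyMeasurable (B * D) ?_
  filter_upwards [ae_prod_sq_add_two_le hD] with p hp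
  rw [Real.norm_eq_abs, abs_of_nonneg (pushDensity_nonneg _ hφ0 _)]
  exact (pushDensity_le _ hφ0 hφB _).trans (mul_le_mul_of_nonneg_left hp hB)

/-- **Mass conservation**: `∫ Pφ dm = ∫ φ dm`. [folklore] -/
theorem integral_transferOp [IsProbabilityMeasure μ] (hD : ∀ᵐ α ∂μ, (E - α) ^ 2 + 2 ≤ D)
    (hφ : Measurable φ)
    (hφ0 : ∀ s, 0 ≤ φ s) (hφB : ∀ s, φ s ≤ B) :
    ∫ y, transferOp μ E φ y ∂(cauchyMeasure 0 1) = ∫ s, φ s ∂(cauchyMeasure 0 1) := by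
  unfold transferOp
  have h := integral_integral_swap (μ := μ) (ν := cauchyMeasure 0 1)
    (f := fun α y => pushDensity (E - α) φ y) (integrable_prod_pushDensity hD hφ hφ0 hφB)
  rw [← h]
  simp_rw [integral_pushDensity]
  simp

/-- Product integrability of `(α, y) ↦ (P_{E-α}φ) log (P_{E-α}φ)`. [folklore] -/
theorem integrable_prod_pushDensity_mul_log [IsProbabilityMeasure μ]
    (hD : ∀ᵐ α ∂μ, (E - α) ^ 2 + 2 ≤ D) (hD1 : 1 ≤ D)
    (hφ : Measurable φ) (hφ0 : ∀ s, 0 < φ s) (hφB : ∀ s, φ s ≤ B) (hB : 1 ≤ B) :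
    Integrable (fun p : ℝ × ℝ => pushDensity (E - p.1) φ p.2 *
      Real.log (pushDensity (E - p.1) φ p.2)) (μ.prod (cauchyMeasure 0 1)) := by
  have hm := measurable_pushDensity_sub hφ E
  have hBD : 1 ≤ B * D := one_le_mul_of_one_le_of_one_le hB hD1
  refine Integrable.of_bound (hm.mul hm.log).aestronglyMeasurable (B * D * Real.log (B * D) + 1) ?_
  filter_upwards [ae_prod_sq_add_two_le hD] with p hp
  rw [Real.norm_eq_abs]
  refine abs_mul_log_le (pushDensity_pos _ hφ0 _) ?_ hBD
  exact (pushDensity_le _ (fun s => (hφ0 s).le) hφB _).trans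
    (mul_le_mul_of_nonneg_left hp (by linarith))

/-- Product integrability of the Hellinger integrand `(√(P_{E-α}φ) - √(Pφ))²`. [folklore] -/
theorem integrable_prod_hellinger [IsProbabilityMeasure μ] (hD : ∀ᵐ α ∂μ, (E - α) ^ 2 + 2 ≤ D)
    (hφ : Measurable φ) (hφ0 : ∀ s, 0 < φ s) (hφB : ∀ s, φ s ≤ B) (hB : 1 ≤ B) :
    Integrable (fun p : ℝ × ℝ => (Real.sqrt (pushDensity (E - p.1) φ p.2) -
      Real.sqrt (transferOp μ E φ p.2)) ^ 2) (μ.prod (cauchyMeasure 0 1)) := by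
  have hm := measurable_pushDensity_sub hφ E
  have hT := measurable_transferOp (μ := μ) (E := E) hφ
  have hφ0' : ∀ s, 0 ≤ φ s := fun s => (hφ0 s).le
  refine Integrable.of_bound ((hm.sqrt.sub (hT.comp measurable_snd).sqrt).pow_const 2).aestronglyMeasurable
    (B * D + B * D) ?_
  filter_upwards [ae_prod_sq_add_two_le hD] with p hp
  have h1 : pushDensity (E - p.1) φ p.2 ≤ B * D :=
    (pushDensity_le _ hφ0' hφB _).trans (mul_le_mul_of_nonneg_left hp (by linarith))
  have h2 : transferOp μ E φ p.2 ≤ B * D := transferOp_le hD hφ0' hφB _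
  have h3 := pushDensity_nonneg (E - p.1) hφ0' p.2
  have h4 := transferOp_nonneg (μ := μ) (E := E) hφ0' p.2
  rw [Real.norm_eq_abs, abs_of_nonneg (sq_nonneg _), sub_sq, Real.sq_sqrt h3, Real.sq_sqrt h4]
  nlinarith [mul_nonneg (Real.sqrt_nonneg (pushDensity (E - p.1) φ p.2))
    (Real.sqrt_nonneg (transferOp μ E φ p.2))]

/-- **The entropy-production step** (Fürstenberg's inequality, quantitative form): for a density
`0 < φ ≤ B` against the Cauchy measure,
`H(Pφ) - H(φ) + ∫∫ (√(P_{E-α}φ) - √(Pφ))² dm dμ ≤ ∫∫ log J_{E-α}(s) φ(s) dm(s) dμ(α)`,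
where `H(ψ) = ∫ ψ log ψ dm`: the mean log-growth of the norm is at least the entropy gain plus the
Hellinger variance of the pushed densities. [folklore] -/
theorem entropy_step [IsProbabilityMeasure μ] (hD : ∀ᵐ α ∂μ, (E - α) ^ 2 + 2 ≤ D) (hD1 : 1 ≤ D)
    (hφ : Measurable φ) (hφ0 : ∀ s, 0 < φ s) (hφB : ∀ s, φ s ≤ B) (hB : 1 ≤ B) :
    (∫ y, transferOp μ E φ y * Real.log (transferOp μ E φ y) ∂(cauchyMeasure 0 1)) -
        (∫ s, φ s * Real.log (φ s) ∂(cauchyMeasure 0 1)) +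
        ∫ α, ∫ y, (Real.sqrt (pushDensity (E - α) φ y) - Real.sqrt (transferOp μ E φ y)) ^ 2
          ∂(cauchyMeasure 0 1) ∂μ ≤
      ∫ α, ∫ s, Real.log (stepJac (E - α) s) * φ s ∂(cauchyMeasure 0 1) ∂μ := by
  have hφ0' : ∀ s, 0 ≤ φ s := fun s => (hφ0 s).le
  have hBD : 1 ≤ B * D := one_le_mul_of_one_le_of_one_le hB hD1
  -- (S2): ∫ α, ∫ y, pD log pD = H(φ) + ∫∫ log J φ
  have hIlog := integrable_prod_pushDensity_mul_log hD hD1 hφ hφ0 hφB hB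
  have S2 : ∫ α, ∫ y, pushDensity (E - α) φ y * Real.log (pushDensity (E - α) φ y)
      ∂(cauchyMeasure 0 1) ∂μ = (∫ s, φ s * Real.log (φ s) ∂(cauchyMeasure 0 1)) +
        ∫ α, ∫ s, Real.log (stepJac (E - α) s) * φ s ∂(cauchyMeasure 0 1) ∂μ := by
    have hpt : ∀ α, ∫ y, pushDensity (E - α) φ y * Real.log (pushDensity (E - α) φ y)
        ∂(cauchyMeasure 0 1) = (∫ s, φ s * Real.log (φ s) ∂(cauchyMeasure 0 1)) +
          ∫ s, Real.log (stepJac (E - α) s) * φ s ∂(cauchyMeasure 0 1) :=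
      fun α => integral_pushDensity_mul_log (E - α) hφ hφ0 hφB hB
    simp_rw [hpt]
    have hJ : Integrable (fun α => ∫ s, Real.log (stepJac (E - α) s) * φ s ∂(cauchyMeasure 0 1)) μ := by
      have := hIlog.integral_prod_left
      have heq : (fun α => ∫ s, Real.log (stepJac (E - α) s) * φ s ∂(cauchyMeasure 0 1)) =
          fun α => (∫ y, pushDensity (E - α) φ y * Real.log (pushDensity (E - α) φ y)
            ∂(cauchyMeasure 0 1)) - ∫ s, φ s * Real.log (φ s) ∂(cauchyMeasure 0 1) := by
        funext α; rw [hpt α]; ring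
      rw [heq]
      exact this.sub (integrable_const _)
    rw [integral_add (integrable_const _) hJ]
    simp
  -- (S4): pointwise in y, Bregman integrated over α
  have S4 : ∀ y, ∫ α, (Real.sqrt (pushDensity (E - α) φ y) - Real.sqrt (transferOp μ E φ y)) ^ 2 ∂μ ≤
      (∫ α, pushDensity (E - α) φ y * Real.log (pushDensity (E - α) φ y) ∂μ) -
        transferOp μ E φ y * Real.log (transferOp μ E φ y) := fun y =>
    integral_sq_sqrt_sub_le ((measurable_pushDensity_sub hφ E).comp (measurable_id.prodMk measurable_const))
      (fun α => pushDensity_pos _ hφ0 y) (ae_pushDensity_le hD hφ0' hφB y)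
  -- integrate (S4) over y
  have hIhel := integrable_prod_hellinger hD hφ hφ0 hφB hB
  have hT := measurable_transferOp (μ := μ) (E := E) hφ
  have hTlog : Integrable (fun y => transferOp μ E φ y * Real.log (transferOp μ E φ y)) (cauchyMeasure 0 1) :=
    integrable_cauchy_of_bound (hT.mul hT.log) (B * D * Real.log (B * D) + 1) fun y =>
      abs_mul_log_le (transferOp_pos hD hφ hφ0 hφB y) (transferOp_le hD hφ0' hφB y) hBD
  have S4' : ∫ y, ∫ α, (Real.sqrt (pushDensity (E - α) φ y) - Real.sqrt (transferOp μ E φ y)) ^ 2 ∂μ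
      ∂(cauchyMeasure 0 1) ≤ (∫ y, ∫ α, pushDensity (E - α) φ y * Real.log (pushDensity (E - α) φ y) ∂μ
        ∂(cauchyMeasure 0 1)) - ∫ y, transferOp μ E φ y * Real.log (transferOp μ E φ y) ∂(cauchyMeasure 0 1) := by
    rw [← integral_sub hIlog.integral_prod_right hTlog]
    exact integral_mono hIhel.integral_prod_right (hIlog.integral_prod_right.sub hTlog) S4
  -- Fubini swaps
  have swap1 : ∫ y, ∫ α, pushDensity (E - α) φ y * Real.log (pushDensity (E - α) φ y) ∂μ
      ∂(cauchyMeasure 0 1) = ∫ α, ∫ y, pushDensity (E - α) φ y * Real.log (pushDensity (E - α) φ y)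
        ∂(cauchyMeasure 0 1) ∂μ :=
    (integral_integral_swap (f := fun α y => pushDensity (E - α) φ y *
      Real.log (pushDensity (E - α) φ y)) hIlog).symm
  have swap2 : ∫ y, ∫ α, (Real.sqrt (pushDensity (E - α) φ y) - Real.sqrt (transferOp μ E φ y)) ^ 2 ∂μ
      ∂(cauchyMeasure 0 1) = ∫ α, ∫ y, (Real.sqrt (pushDensity (E - α) φ y) -
        Real.sqrt (transferOp μ E φ y)) ^ 2 ∂(cauchyMeasure 0 1) ∂μ :=
    (integral_integral_swap (f := fun α y => (Real.sqrt (pushDensity (E - α) φ y) -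
      Real.sqrt (transferOp μ E φ y)) ^ 2) hIhel).symm
  rw [swap1, swap2, S2] at S4'
  linarith

end Step
section NonInvariance

variable {μ : Measure ℝ} {E D B K : ℝ} {φ : ℝ → ℝ}

/-- `|∫ g ψ - ∫ g ψ'| ≤ 2 √(∫ (√ψ - √ψ')²)` for probability densities `ψ, ψ'` and a test function
`|g| ≤ 1` (AM–GM on `|ψ - ψ'| = |√ψ - √ψ'| (√ψ + √ψ')`). [folklore] -/
theorem abs_integral_sub_le_two_hellinger {ν : Measure ℝ} [IsFiniteMeasure ν] {ψ ψ' g : ℝ → ℝ}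
    (hg : Measurable g)
    (hψ0 : ∀ y, 0 ≤ ψ y) (hψ'0 : ∀ y, 0 ≤ ψ' y) (hg1 : ∀ y, |g y| ≤ 1)
    (hψi : Integrable ψ ν) (hψ'i : Integrable ψ' ν)
    (hψ1 : ∫ y, ψ y ∂ν = 1) (hψ'1 : ∫ y, ψ' y ∂ν = 1)
    (hH : Integrable (fun y => (Real.sqrt (ψ y) - Real.sqrt (ψ' y)) ^ 2) ν) :
    |(∫ y, g y * ψ y ∂ν) - ∫ y, g y * ψ' y ∂ν| ≤
      2 * Real.sqrt (∫ y, (Real.sqrt (ψ y) - Real.sqrt (ψ' y)) ^ 2 ∂ν) := by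
  set h2 := ∫ y, (Real.sqrt (ψ y) - Real.sqrt (ψ' y)) ^ 2 ∂ν with h2def
  have h2nn : 0 ≤ h2 := integral_nonneg fun y => sq_nonneg _
  have hgi : ∀ {f : ℝ → ℝ}, Integrable f ν → Integrable (fun y => g y * f y) ν := fun hf =>
    hf.bdd_mul hg.aestronglyMeasurable (Eventually.of_forall fun y => by
      rw [Real.norm_eq_abs]; exact hg1 y) (c := 1)
  -- ∫ |ψ - ψ'| ≤ h2/(2ε) + 2ε for every ε > 0
  have hL1 : ∀ ε : ℝ, 0 < ε → ∫ y, |ψ y - ψ' y| ∂ν ≤ h2 / (2 * ε) + 2 * ε := by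
    intro ε hε
    have hpt : ∀ y, |ψ y - ψ' y| ≤ (Real.sqrt (ψ y) - Real.sqrt (ψ' y)) ^ 2 / (2 * ε) +
        ε / 2 * (2 * ψ y + 2 * ψ' y) := by
      intro y
      set a := Real.sqrt (ψ y)
      set b := Real.sqrt (ψ' y)
      have ha : a ^ 2 = ψ y := Real.sq_sqrt (hψ0 y)
      have hb : b ^ 2 = ψ' y := Real.sq_sqrt (hψ'0 y)
      have ha0 : 0 ≤ a := Real.sqrt_nonneg _
      have hb0 : 0 ≤ b := Real.sqrt_nonneg _
      have hfac : |ψ y - ψ' y| = |a - b| * (a + b) := by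
        rw [← ha, ← hb, sq_sub_sq, abs_mul, abs_of_nonneg (by positivity : 0 ≤ a + b), mul_comm]
      rw [hfac, ← ha, ← hb]
      have hamgm : |a - b| * (a + b) ≤ (a - b) ^ 2 / (2 * ε) + ε / 2 * (a + b) ^ 2 := by
        have hsq : |a - b| ^ 2 = (a - b) ^ 2 := sq_abs _
        have := sq_nonneg (|a - b| / Real.sqrt (2 * ε) * 1 - Real.sqrt (2 * ε) / 2 * (a + b))
        have key : 0 ≤ (|a - b| - ε * (a + b)) ^ 2 := sq_nonneg _
        have hε2 : (0 : ℝ) < 2 * ε := by positivity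
        rw [div_add' _ _ _ hε2.ne', le_div_iff₀ hε2]
        nlinarith [key, abs_nonneg (a - b), hsq]
      calc |a - b| * (a + b) ≤ (a - b) ^ 2 / (2 * ε) + ε / 2 * (a + b) ^ 2 := hamgm
        _ ≤ (a - b) ^ 2 / (2 * ε) + ε / 2 * (2 * a ^ 2 + 2 * b ^ 2) := by
            gcongr
            nlinarith [sq_nonneg (a - b)]
    have hri : Integrable (fun y => (Real.sqrt (ψ y) - Real.sqrt (ψ' y)) ^ 2 / (2 * ε) +
        ε / 2 * (2 * ψ y + 2 * ψ' y)) ν :=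
      (hH.div_const _).add (((hψi.const_mul 2).add (hψ'i.const_mul 2)).const_mul _)
    calc ∫ y, |ψ y - ψ' y| ∂ν ≤ ∫ y, ((Real.sqrt (ψ y) - Real.sqrt (ψ' y)) ^ 2 / (2 * ε) +
          ε / 2 * (2 * ψ y + 2 * ψ' y)) ∂ν :=
          integral_mono (hψi.sub hψ'i).abs hri hpt
      _ = h2 / (2 * ε) + ε / 2 * (2 * 1 + 2 * 1) := by
          have e1 : ∫ y, ((Real.sqrt (ψ y) - Real.sqrt (ψ' y)) ^ 2 / (2 * ε) +
              ε / 2 * (2 * ψ y + 2 * ψ' y)) ∂ν = (∫ y, (Real.sqrt (ψ y) - Real.sqrt (ψ' y)) ^ 2 / (2 * ε) ∂ν) +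
                ∫ y, ε / 2 * (2 * ψ y + 2 * ψ' y) ∂ν :=
            integral_add (hH.div_const _) (((hψi.const_mul 2).add (hψ'i.const_mul 2)).const_mul _)
          have e2 : ∫ y, (Real.sqrt (ψ y) - Real.sqrt (ψ' y)) ^ 2 / (2 * ε) ∂ν = h2 / (2 * ε) :=
            integral_div _ _
          have e3 : ∫ y, ε / 2 * (2 * ψ y + 2 * ψ' y) ∂ν = ε / 2 * ∫ y, (2 * ψ y + 2 * ψ' y) ∂ν :=
            integral_const_mul _ _
          have e4 : ∫ y, (2 * ψ y + 2 * ψ' y) ∂ν = (∫ y, 2 * ψ y ∂ν) + ∫ y, 2 * ψ' y ∂ν :=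
            integral_add (hψi.const_mul 2) (hψ'i.const_mul 2)
          have e5 : ∫ y, 2 * ψ y ∂ν = 2 * ∫ y, ψ y ∂ν := integral_const_mul _ _
          have e6 : ∫ y, 2 * ψ' y ∂ν = 2 * ∫ y, ψ' y ∂ν := integral_const_mul _ _
          rw [e1, e2, e3, e4, e5, e6, hψ1, hψ'1]
      _ = h2 / (2 * ε) + 2 * ε := by ring
  -- optimise ε
  have hL1' : ∫ y, |ψ y - ψ' y| ∂ν ≤ 2 * Real.sqrt h2 := by
    rcases eq_or_lt_of_le h2nn with h0 | hpos
    · rw [← h0, Real.sqrt_zero, mul_zero]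
      refine le_of_forall_pos_le_add fun ε hε => ?_
      have := hL1 (ε / 2) (by positivity)
      rw [← h0, zero_div] at this
      linarith
    · have hs : 0 < Real.sqrt h2 := Real.sqrt_pos.mpr hpos
      have := hL1 (Real.sqrt h2 / 2) (by positivity)
      have hsq : h2 = Real.sqrt h2 ^ 2 := (Real.sq_sqrt h2nn).symm
      calc ∫ y, |ψ y - ψ' y| ∂ν ≤ h2 / (2 * (Real.sqrt h2 / 2)) + 2 * (Real.sqrt h2 / 2) := this
        _ = 2 * Real.sqrt h2 := by
            rw [hsq, Real.sqrt_sq hs.le]; field_simp; ring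
  calc |(∫ y, g y * ψ y ∂ν) - ∫ y, g y * ψ' y ∂ν|
      = |∫ y, g y * (ψ y - ψ' y) ∂ν| := by
        rw [← integral_sub (hgi hψi) (hgi hψ'i)]
        congr 1
        exact integral_congr_ae (Eventually.of_forall fun y => by ring)
    _ ≤ ∫ y, |g y * (ψ y - ψ' y)| ∂ν := abs_integral_le_integral_abs
    _ ≤ ∫ y, |ψ y - ψ' y| ∂ν := by
        refine integral_mono (hgi (hψi.sub hψ'i)).abs (hψi.sub hψ'i).abs fun y => ?_
        rw [abs_mul]
        exact mul_le_of_le_one_left (abs_nonneg _) (hg1 y)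
    _ ≤ 2 * Real.sqrt h2 := hL1'

/-- **The shear identity**: the push-forwards by `A(a)` and `A(a')` differ by the translation
`s ↦ s + (a - a')` — `∫ 1_{a - 1/y ≤ q} (P_{a'}φ)(y) dm(y) = ∫ 1_{s ≤ q - (a - a')} φ(s) dm(s)`.
[folklore] -/
theorem integral_indicator_pushDensity (a a' q : ℝ) (φ : ℝ → ℝ) :
    ∫ y, Set.indicator {y | a - y⁻¹ ≤ q} (fun _ => (1 : ℝ)) y * pushDensity a' φ y
        ∂(cauchyMeasure 0 1) =
      ∫ s, Set.indicator (Set.Iic (q - (a - a'))) (fun _ => (1 : ℝ)) s * φ s ∂(cauchyMeasure 0 1) := by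
  rw [← integral_mobStep_cauchy a' (fun y => Set.indicator {y | a - y⁻¹ ≤ q} (fun _ => (1 : ℝ)) y) φ]
  refine integral_congr_ae (Eventually.of_forall fun s => ?_)
  have hiff : a - (a' - s) ≤ q ↔ s ≤ q - (a - a') := by constructor <;> intro h <;> linarith
  have hind : Set.indicator {y : ℝ | a - y⁻¹ ≤ q} (fun _ => (1 : ℝ)) (mobStep a' s) =
      Set.indicator (Set.Iic (q - (a - a'))) (fun _ => (1 : ℝ)) s := by
    unfold mobStep
    simp only [Set.indicator_apply, Set.mem_setOf_eq, inv_inv, Set.mem_Iic, hiff]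
  simp only [hind]

/-- The distribution function `F(q) = ∫ 1_{s ≤ q} φ dm` of the density `φ`. [folklore] -/
theorem cdf_shift_le {φ : ℝ → ℝ} {B : ℝ} (hφ : Measurable φ) (hφ0 : ∀ s, 0 ≤ φ s) (hφB : ∀ s, φ s ≤ B)
    (hφ1 : ∫ s, φ s ∂(cauchyMeasure 0 1) = 1) (a a' q : ℝ) :
    |(∫ s, Set.indicator (Set.Iic q) (fun _ => (1 : ℝ)) s * φ s ∂(cauchyMeasure 0 1)) -
        ∫ s, Set.indicator (Set.Iic (q - (a - a'))) (fun _ => (1 : ℝ)) s * φ s ∂(cauchyMeasure 0 1)| ≤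
      2 * Real.sqrt (∫ y, (Real.sqrt (pushDensity a φ y) - Real.sqrt (pushDensity a' φ y)) ^ 2
        ∂(cauchyMeasure 0 1)) := by
  have hq : (∫ s, Set.indicator (Set.Iic q) (fun _ => (1 : ℝ)) s * φ s ∂(cauchyMeasure 0 1)) =
      ∫ y, Set.indicator {y | a - y⁻¹ ≤ q} (fun _ => (1 : ℝ)) y * pushDensity a φ y
        ∂(cauchyMeasure 0 1) := by
    rw [integral_indicator_pushDensity a a q φ, sub_self, sub_zero]
  rw [hq, ← integral_indicator_pushDensity a a' q φ]
  have hB1 : ∀ b : ℝ, Integrable (pushDensity b φ) (cauchyMeasure 0 1) := fun b =>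
    integrable_cauchy_of_bound (measurable_pushDensity b hφ) (B * (b ^ 2 + 2)) fun y => by
      rw [abs_of_nonneg (pushDensity_nonneg b hφ0 y)]; exact pushDensity_le b hφ0 hφB y
  have hmass : ∀ b : ℝ, ∫ y, pushDensity b φ y ∂(cauchyMeasure 0 1) = 1 := fun b => by
    rw [integral_pushDensity, hφ1]
  have hmeas : Measurable (Set.indicator {y : ℝ | a - y⁻¹ ≤ q} (fun _ => (1 : ℝ))) :=
    measurable_const.indicator (measurableSet_le (measurable_const.sub measurable_inv) measurable_const)
  refine abs_integral_sub_le_two_hellinger hmeas (pushDensity_nonneg a hφ0) (pushDensity_nonneg a' hφ0)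
    (fun y => ?_) (hB1 a) (hB1 a') (hmass a) (hmass a') ?_
  · simp only [Set.indicator_apply]
    split_ifs <;> simp
  · refine integrable_cauchy_of_bound (((measurable_pushDensity a hφ).sqrt.sub
      (measurable_pushDensity a' hφ).sqrt).pow_const 2) (B * (a ^ 2 + 2) + B * (a' ^ 2 + 2)) fun y => ?_
    have h1 := pushDensity_le a hφ0 hφB y
    have h2 := pushDensity_le a' hφ0 hφB y
    have h3 := pushDensity_nonneg a hφ0 y
    have h4 := pushDensity_nonneg a' hφ0 y
    rw [abs_of_nonneg (sq_nonneg _), sub_sq, Real.sq_sqrt h3, Real.sq_sqrt h4]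
    nlinarith [mul_nonneg (Real.sqrt_nonneg (pushDensity a φ y)) (Real.sqrt_nonneg (pushDensity a' φ y))]

/-- **Uniform non-invariance of tight densities under the shears**: if `φ` is a probability
density (against the Cauchy measure) with tails `∫ 1_{|s| > L} φ ≤ C/L`, then for
`|a - a'| ≥ t₀ > 0` the Hellinger distance between the push-forwards by `A(a)` and `A(a')` is at
least `3/(8(16C/t₀ + 1))`: an a.c. tight measure on the line cannot be almost invariant under a
translation by `≥ t₀`. [folklore] -/
theorem hellinger_pair_lower {φ : ℝ → ℝ} {B C : ℝ} (hφ : Measurable φ) (hφ0 : ∀ s, 0 ≤ φ s)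
    (hφB : ∀ s, φ s ≤ B) (hφ1 : ∫ s, φ s ∂(cauchyMeasure 0 1) = 1) (hC : 0 < C)
    (htail : ∀ L, 0 < L → ∫ s, Set.indicator {s | L < |s|} (fun _ => (1 : ℝ)) s * φ s
      ∂(cauchyMeasure 0 1) ≤ C / L)
    {a a' t₀ : ℝ} (ht₀ : 0 < t₀) (hsep : t₀ ≤ |a - a'|) :
    3 / (8 * (16 * C / t₀ + 1)) ≤ Real.sqrt (∫ y, (Real.sqrt (pushDensity a φ y) -
      Real.sqrt (pushDensity a' φ y)) ^ 2 ∂(cauchyMeasure 0 1)) := by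
  set h := Real.sqrt (∫ y, (Real.sqrt (pushDensity a φ y) -
      Real.sqrt (pushDensity a' φ y)) ^ 2 ∂(cauchyMeasure 0 1)) with hdef
  have h0 : 0 ≤ h := Real.sqrt_nonneg _
  -- the distribution function and its shift inequality for the step τ = |a - a'|
  set F : ℝ → ℝ := fun q => ∫ s, Set.indicator (Set.Iic q) (fun _ => (1 : ℝ)) s * φ s
    ∂(cauchyMeasure 0 1) with hF
  set τ := |a - a'| with hτ
  have hτ0 : 0 < τ := ht₀.trans_le hsep
  have hshift : ∀ q, F q - F (q - τ) ≤ 2 * h := by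
    intro q
    rcases le_or_gt 0 (a - a') with hpos | hneg
    · have := cdf_shift_le hφ hφ0 hφB hφ1 a a' q
      rw [abs_of_nonneg hpos] at hτ
      rw [hτ]
      exact (le_abs_self _).trans this
    · have := cdf_shift_le hφ hφ0 hφB hφ1 a a' (q - τ)
      rw [abs_of_neg hneg] at hτ
      have hq : q - τ - (a - a') = q := by rw [hτ]; ring
      rw [hq] at this
      have this' : |F (q - τ) - F q| ≤ 2 * h := this
      calc F q - F (q - τ) = -(F (q - τ) - F q) := by ring
        _ ≤ |F (q - τ) - F q| := neg_le_abs _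
        _ ≤ 2 * h := this'
  -- telescoping over k steps
  have htel : ∀ (L : ℝ) (k : ℕ), F L - F (L - k * τ) ≤ k * (2 * h) := by
    intro L k
    induction k with
    | zero => simp
    | succ k ih =>
      have := hshift (L - k * τ)
      have e : L - k * τ - τ = L - ((k : ℝ) + 1) * τ := by ring
      rw [e] at this
      push_cast
      linarith
  -- pointwise facts about the indicators
  have hind_i : ∀ q, Integrable (fun s => Set.indicator (Set.Iic q) (fun _ => (1 : ℝ)) s * φ s)
      (cauchyMeasure 0 1) := fun q =>
    integrable_cauchy_of_bound ((measurable_const.indicator measurableSet_Iic).mul hφ) B fun s => by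
      rw [abs_mul, abs_of_nonneg (hφ0 s)]
      refine (mul_le_of_le_one_left (hφ0 s) ?_).trans (hφB s)
      simp only [Set.indicator_apply]; split_ifs <;> simp
  have htail_i : ∀ L, Integrable (fun s => Set.indicator {s | L < |s|} (fun _ => (1 : ℝ)) s * φ s)
      (cauchyMeasure 0 1) := fun L =>
    integrable_cauchy_of_bound ((measurable_const.indicator
      (measurableSet_lt measurable_const continuous_abs.measurable)).mul hφ) B fun s => by
      rw [abs_mul, abs_of_nonneg (hφ0 s)]
      refine (mul_le_of_le_one_left (hφ0 s) ?_).trans (hφB s)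
      simp only [Set.indicator_apply]; split_ifs <;> simp
  have hφi : Integrable φ (cauchyMeasure 0 1) :=
    integrable_cauchy_of_bound hφ B fun s => by rw [abs_of_nonneg (hφ0 s)]; exact hφB s
  -- F(L) ≥ 1 - C/L
  have hFL : ∀ L, 0 < L → 1 - C / L ≤ F L := by
    intro L hL
    have hpt : ∀ s, φ s - Set.indicator {s | L < |s|} (fun _ => (1 : ℝ)) s * φ s ≤
        Set.indicator (Set.Iic L) (fun _ => (1 : ℝ)) s * φ s := by
      intro s
      by_cases hs : s ≤ L
      · simp only [Set.indicator_apply, Set.mem_Iic, hs, if_true, one_mul, Set.mem_setOf_eq]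
        split_ifs <;> nlinarith [hφ0 s]
      · have : L < |s| := (not_le.mp hs).trans_le (le_abs_self s)
        simp only [Set.indicator_apply, Set.mem_setOf_eq, this, if_true, Set.mem_Iic, hs, if_false]
        simp
    have := integral_mono (f := fun s => φ s - Set.indicator {s | L < |s|} (fun _ => (1 : ℝ)) s * φ s)
      (hφi.sub (htail_i L)) (hind_i L) hpt
    have e : ∫ s, (φ s - Set.indicator {s | L < |s|} (fun _ => (1 : ℝ)) s * φ s) ∂(cauchyMeasure 0 1) =
        (∫ s, φ s ∂(cauchyMeasure 0 1)) -
          ∫ s, Set.indicator {s | L < |s|} (fun _ => (1 : ℝ)) s * φ s ∂(cauchyMeasure 0 1) :=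
      integral_sub hφi (htail_i L)
    rw [e, hφ1] at this
    have ht := htail L hL
    show 1 - C / L ≤ F L
    linarith
  -- F(q) ≤ C/L when q < -L
  have hFlow : ∀ L q, 0 < L → q < -L → F q ≤ C / L := by
    intro L q hL hq
    have hpt : ∀ s, Set.indicator (Set.Iic q) (fun _ => (1 : ℝ)) s * φ s ≤
        Set.indicator {s | L < |s|} (fun _ => (1 : ℝ)) s * φ s := by
      intro s
      by_cases hs : s ≤ q
      · have : L < |s| := by
          have : s < -L := hs.trans_lt hq
          calc L < -s := by linarith
            _ ≤ |s| := neg_le_abs s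
        simp [hs, this]
      · simp only [Set.indicator_apply, Set.mem_Iic, hs, if_false, zero_mul]
        exact mul_nonneg (Set.indicator_nonneg (fun _ _ => zero_le_one) _) (hφ0 s)
    exact (integral_mono (hind_i q) (htail_i L) hpt).trans (htail L hL)
  -- choose L = 8C, k = ⌊2L/τ⌋ + 1
  set L := 8 * C with hL
  have hL0 : 0 < L := by positivity
  set k : ℕ := ⌊2 * L / τ⌋₊ + 1 with hk
  have hk1 : 2 * L < k * τ := by
    have := Nat.lt_floor_add_one (2 * L / τ)
    rw [div_lt_iff₀ hτ0] at this
    rw [hk]; push_cast; exact this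
  have hk2 : (k : ℝ) ≤ 2 * L / τ + 1 := by
    rw [hk]; push_cast
    have := Nat.floor_le (by positivity : 0 ≤ 2 * L / τ)
    linarith
  have h34 : 3 / 4 ≤ k * (2 * h) := by
    have h1 := hFL L hL0
    have h2 := hFlow L (L - k * τ) hL0 (by linarith)
    have h3 := htel L k
    have hCL : C / L = 1 / 8 := by rw [hL]; field_simp
    rw [hCL] at h1 h2
    linarith
  -- conclude
  have hkpos : (0 : ℝ) < 16 * C / t₀ + 1 := by positivity
  have hkle : (k : ℝ) ≤ 16 * C / t₀ + 1 := by
    calc (k : ℝ) ≤ 2 * L / τ + 1 := hk2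
      _ ≤ 16 * C / t₀ + 1 := by
          rw [hL]
          have : 2 * (8 * C) / τ ≤ 16 * C / t₀ := by
            rw [div_le_div_iff₀ hτ0 ht₀]; nlinarith
          linarith
  rw [div_le_iff₀ (by positivity)]
  calc 3 = 4 * (3 / 4) := by norm_num
    _ ≤ 4 * (k * (2 * h)) := by linarith
    _ = 8 * k * h := by ring
    _ ≤ 8 * (16 * C / t₀ + 1) * h := by gcongr
    _ = h * (8 * (16 * C / t₀ + 1)) := by ring

/-- **The Hellinger variance of the pushed densities is bounded below** (the quantitative
non-invariance input of the positivity proof): for a probability density `0 < φ ≤ B` with tails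
`∫ 1_{|s|>L} φ ≤ C/L` and a site law with `μ[p,q] ≤ K(q-p)`,
`∫∫ (√(P_{E-α}φ) - √(Pφ))² dm dμ ≥ (3/(8(64CK+1)))²/8`. [folklore] -/
theorem hellinger_variance_lower [IsProbabilityMeasure μ]
    (hK : ∀ p q : ℝ, μ (Set.Icc p q) ≤ ENNReal.ofReal (K * (q - p))) (hKpos : 0 < K)
    (hD : ∀ᵐ α ∂μ, (E - α) ^ 2 + 2 ≤ D)
    (hφ : Measurable φ) (hφ0 : ∀ s, 0 < φ s) (hφB : ∀ s, φ s ≤ B) (hB : 1 ≤ B)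
    (hφ1 : ∫ s, φ s ∂(cauchyMeasure 0 1) = 1) {C : ℝ} (hC : 0 < C)
    (htail : ∀ L, 0 < L → ∫ s, Set.indicator {s | L < |s|} (fun _ => (1 : ℝ)) s * φ s
      ∂(cauchyMeasure 0 1) ≤ C / L) :
    (3 / (8 * (64 * C * K + 1))) ^ 2 / 8 ≤
      ∫ α, ∫ y, (Real.sqrt (pushDensity (E - α) φ y) - Real.sqrt (transferOp μ E φ y)) ^ 2
        ∂(cauchyMeasure 0 1) ∂μ := by
  have hφ0' : ∀ s, 0 ≤ φ s := fun s => (hφ0 s).le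
  set δ := 3 / (8 * (64 * C * K + 1)) with hδ
  set t₀ := 1 / (4 * K) with ht₀
  have ht₀0 : 0 < t₀ := by positivity
  have hδ' : δ = 3 / (8 * (16 * C / t₀ + 1)) := by
    rw [hδ, ht₀]; congr 2; field_simp; ring
  set g : ℝ → ℝ := fun α => ∫ y, (Real.sqrt (pushDensity (E - α) φ y) -
    Real.sqrt (transferOp μ E φ y)) ^ 2 ∂(cauchyMeasure 0 1) with hg
  set R := ∫ α, g α ∂μ with hR
  have hgi : Integrable g μ := (integrable_prod_hellinger hD hφ hφ0 hφB hB).integral_prod_left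
  have hg0 : ∀ α, 0 ≤ g α := fun α => integral_nonneg fun y => sq_nonneg _
  have hT := measurable_transferOp (μ := μ) (E := E) hφ
  -- integrability in y of the Hellinger integrands, for every α
  have hIy : ∀ α, Integrable (fun y => (Real.sqrt (pushDensity (E - α) φ y) -
      Real.sqrt (transferOp μ E φ y)) ^ 2) (cauchyMeasure 0 1) := by
    intro α
    refine integrable_cauchy_of_bound (((measurable_pushDensity _ hφ).sqrt.sub hT.sqrt).pow_const 2)
      (B * ((E - α) ^ 2 + 2) + B * D) fun y => ?_
    have h1 := pushDensity_le (E - α) hφ0' hφB y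
    have h2 : transferOp μ E φ y ≤ B * D := transferOp_le hD hφ0' hφB _
    have h3 := pushDensity_nonneg (E - α) hφ0' y
    have h4 := transferOp_nonneg (μ := μ) (E := E) hφ0' y
    rw [abs_of_nonneg (sq_nonneg _), sub_sq, Real.sq_sqrt h3, Real.sq_sqrt h4]
    nlinarith [mul_nonneg (Real.sqrt_nonneg (pushDensity (E - α) φ y))
      (Real.sqrt_nonneg (transferOp μ E φ y))]
  -- (i)+(ii): δ² 1_{t₀ ≤ |α - α'|} ≤ 2 g α + 2 g α'
  have hpair : ∀ α α', δ ^ 2 * Set.indicator {α' | t₀ ≤ |α - α'|} (fun _ => (1 : ℝ)) α' ≤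
      2 * g α + 2 * g α' := by
    intro α α'
    by_cases hsep : t₀ ≤ |α - α'|
    · have hsep' : t₀ ≤ |(E - α) - (E - α')| := by
        rw [show (E - α) - (E - α') = -(α - α') by ring, abs_neg]; exact hsep
      have hlow := hellinger_pair_lower hφ hφ0' hφB hφ1 hC htail ht₀0 hsep'
      rw [← hδ'] at hlow
      have hδ0 : 0 ≤ δ := by rw [hδ]; positivity
      have hsq : δ ^ 2 ≤ ∫ y, (Real.sqrt (pushDensity (E - α) φ y) -
          Real.sqrt (pushDensity (E - α') φ y)) ^ 2 ∂(cauchyMeasure 0 1) := by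
        calc δ ^ 2 ≤ (Real.sqrt (∫ y, (Real.sqrt (pushDensity (E - α) φ y) -
            Real.sqrt (pushDensity (E - α') φ y)) ^ 2 ∂(cauchyMeasure 0 1))) ^ 2 :=
              pow_le_pow_left₀ hδ0 hlow 2
          _ = _ := Real.sq_sqrt (integral_nonneg fun y => sq_nonneg _)
      have htri : ∫ y, (Real.sqrt (pushDensity (E - α) φ y) -
          Real.sqrt (pushDensity (E - α') φ y)) ^ 2 ∂(cauchyMeasure 0 1) ≤ 2 * g α + 2 * g α' := by
        have hpt : ∀ y, (Real.sqrt (pushDensity (E - α) φ y) - Real.sqrt (pushDensity (E - α') φ y)) ^ 2 ≤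
            2 * (Real.sqrt (pushDensity (E - α) φ y) - Real.sqrt (transferOp μ E φ y)) ^ 2 +
            2 * (Real.sqrt (pushDensity (E - α') φ y) - Real.sqrt (transferOp μ E φ y)) ^ 2 := by
          intro y
          nlinarith [sq_nonneg (Real.sqrt (pushDensity (E - α) φ y) +
            Real.sqrt (pushDensity (E - α') φ y) - 2 * Real.sqrt (transferOp μ E φ y))]
        have hm : Integrable (fun y => (Real.sqrt (pushDensity (E - α) φ y) -
            Real.sqrt (pushDensity (E - α') φ y)) ^ 2) (cauchyMeasure 0 1) := by
          refine integrable_cauchy_of_bound (((measurable_pushDensity _ hφ).sqrt.sub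
            (measurable_pushDensity _ hφ).sqrt).pow_const 2)
            (B * ((E - α) ^ 2 + 2) + B * ((E - α') ^ 2 + 2)) fun y => ?_
          have h1 := pushDensity_le (E - α) hφ0' hφB y
          have h2 := pushDensity_le (E - α') hφ0' hφB y
          have h3 := pushDensity_nonneg (E - α) hφ0' y
          have h4 := pushDensity_nonneg (E - α') hφ0' y
          rw [abs_of_nonneg (sq_nonneg _), sub_sq, Real.sq_sqrt h3, Real.sq_sqrt h4]
          nlinarith [mul_nonneg (Real.sqrt_nonneg (pushDensity (E - α) φ y))
            (Real.sqrt_nonneg (pushDensity (E - α') φ y))]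
        calc _ ≤ ∫ y, (2 * (Real.sqrt (pushDensity (E - α) φ y) - Real.sqrt (transferOp μ E φ y)) ^ 2 +
            2 * (Real.sqrt (pushDensity (E - α') φ y) - Real.sqrt (transferOp μ E φ y)) ^ 2)
              ∂(cauchyMeasure 0 1) := integral_mono hm (((hIy α).const_mul 2).add ((hIy α').const_mul 2)) hpt
          _ = 2 * g α + 2 * g α' := by
              have e1 : ∫ y, (2 * (Real.sqrt (pushDensity (E - α) φ y) - Real.sqrt (transferOp μ E φ y)) ^ 2 +
                  2 * (Real.sqrt (pushDensity (E - α') φ y) - Real.sqrt (transferOp μ E φ y)) ^ 2)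
                    ∂(cauchyMeasure 0 1) =
                  (∫ y, 2 * (Real.sqrt (pushDensity (E - α) φ y) - Real.sqrt (transferOp μ E φ y)) ^ 2
                    ∂(cauchyMeasure 0 1)) +
                  ∫ y, 2 * (Real.sqrt (pushDensity (E - α') φ y) - Real.sqrt (transferOp μ E φ y)) ^ 2
                    ∂(cauchyMeasure 0 1) := integral_add ((hIy α).const_mul 2) ((hIy α').const_mul 2)
              rw [e1, integral_const_mul, integral_const_mul]
      calc δ ^ 2 * Set.indicator {α' | t₀ ≤ |α - α'|} (fun _ => (1 : ℝ)) α' ≤ δ ^ 2 * 1 := by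
            gcongr
            simp only [Set.indicator_apply]; split_ifs <;> simp
        _ ≤ 2 * g α + 2 * g α' := by rw [mul_one]; exact hsq.trans htri
    · simp only [Set.indicator_apply, Set.mem_setOf_eq, hsep, if_false, mul_zero]
      nlinarith [hg0 α, hg0 α']
  -- (iv): integrate over α'
  have hmeasI : ∀ α, MeasurableSet {α' : ℝ | t₀ ≤ |α - α'|} := fun α =>
    measurableSet_le measurable_const (continuous_abs.measurable.comp (measurable_const.sub measurable_id))
  have hhalf : ∀ α, (1 : ℝ) / 2 ≤ μ.real {α' | t₀ ≤ |α - α'|} := by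
    intro α
    have hc : μ {α' | t₀ ≤ |α - α'|}ᶜ ≤ ENNReal.ofReal (K * (2 * t₀)) := by
      have hsub : {α' | t₀ ≤ |α - α'|}ᶜ ⊆ Set.Icc (α - t₀) (α + t₀) := by
        intro x hx
        simp only [Set.mem_compl_iff, Set.mem_setOf_eq, not_le] at hx
        rw [abs_lt] at hx
        constructor <;> linarith
      calc μ {α' | t₀ ≤ |α - α'|}ᶜ ≤ μ (Set.Icc (α - t₀) (α + t₀)) := measure_mono hsub
        _ ≤ ENNReal.ofReal (K * (α + t₀ - (α - t₀))) := hK _ _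
        _ = ENNReal.ofReal (K * (2 * t₀)) := by ring_nf
    have hK2 : K * (2 * t₀) = 1 / 2 := by rw [ht₀]; field_simp; ring
    have h1 : μ.real {α' | t₀ ≤ |α - α'|} = 1 - μ.real {α' | t₀ ≤ |α - α'|}ᶜ := by
      rw [measureReal_compl (hmeasI α), probReal_univ]; ring
    have h2 : μ.real {α' | t₀ ≤ |α - α'|}ᶜ ≤ 1 / 2 := by
      rw [← hK2, measureReal_def]
      exact ENNReal.toReal_le_of_le_ofReal (by positivity) hc
    linarith
  have hstep : ∀ α, δ ^ 2 / 2 ≤ 2 * g α + 2 * R := by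
    intro α
    have hi1 : Integrable (fun α' => δ ^ 2 * Set.indicator {α' | t₀ ≤ |α - α'|} (fun _ => (1 : ℝ)) α') μ :=
      ((integrable_const (1 : ℝ)).indicator (hmeasI α)).const_mul _
    have hi2 : Integrable (fun α' => 2 * g α + 2 * g α') μ := (integrable_const _).add (hgi.const_mul 2)
    have hint := integral_mono hi1 hi2 (hpair α)
    have e1 : ∫ α', δ ^ 2 * Set.indicator {α' | t₀ ≤ |α - α'|} (fun _ => (1 : ℝ)) α' ∂μ =
        δ ^ 2 * μ.real {α' | t₀ ≤ |α - α'|} := by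
      rw [integral_const_mul, integral_indicator (hmeasI α), setIntegral_const, smul_eq_mul, mul_one]
    have e2 : ∫ α', (2 * g α + 2 * g α') ∂μ = 2 * g α + 2 * R := by
      have : ∫ α', (2 * g α + 2 * g α') ∂μ = (∫ _α', 2 * g α ∂μ) + ∫ α', 2 * g α' ∂μ :=
        integral_add (integrable_const _) (hgi.const_mul 2)
      rw [this, integral_const_mul, integral_const, probReal_univ, one_smul, integral_const_mul]
    rw [e1, e2] at hint
    have := hhalf α
    have hδ2 : 0 ≤ δ ^ 2 := sq_nonneg _
    nlinarith
  -- (v): integrate over α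
  have hfin : δ ^ 2 / 2 ≤ 2 * R + 2 * R := by
    have hint := integral_mono (f := fun _ => δ ^ 2 / 2) (g := fun α => 2 * g α + 2 * R)
      (integrable_const (δ ^ 2 / 2)) ((hgi.const_mul 2).add (integrable_const _)) hstep
    have e : ∫ α, (2 * g α + 2 * R) ∂μ = 2 * R + 2 * R := by
      have : ∫ α, (2 * g α + 2 * R) ∂μ = (∫ α, 2 * g α ∂μ) + ∫ _α, 2 * R ∂μ :=
        integral_add (hgi.const_mul 2) (integrable_const _)
      rw [this, integral_const_mul, integral_const, probReal_univ, one_smul]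
    rw [integral_const, probReal_univ, one_smul, e] at hint
    exact hint
  show δ ^ 2 / 8 ≤ R
  linarith

end NonInvariance

/-! ### The slope cocycle of the transfer matrices -/

/-- The vector `(1, s)` of slope `s`. [folklore] -/
def baseVec (s : ℝ) : EuclideanSpace ℝ (Fin 2) := WithLp.toLp 2 ![1, s]

/-- The slope `v₁/v₀` of a plane vector (junk value `0` on the vertical axis). [folklore] -/
def slope (v : EuclideanSpace ℝ (Fin 2)) : ℝ := v 1 / v 0

/-- First coordinate of `(1, s)`. [folklore] -/
@[simp] theorem baseVec_zero (s : ℝ) : baseVec s 0 = 1 := by simp [baseVec]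

/-- Second coordinate of `(1, s)`. [folklore] -/
@[simp] theorem baseVec_one (s : ℝ) : baseVec s 1 = s := by simp [baseVec]

/-- The slope of `(1, s)` is `s`. [folklore] -/
@[simp] theorem slope_baseVec (s : ℝ) : slope (baseVec s) = s := by simp [slope]

/-- Continuity of `baseVec`. [folklore] -/
theorem continuous_baseVec : Continuous baseVec := by
  unfold baseVec
  refine (PiLp.continuous_toLp 2 _).comp (continuous_pi fun i => ?_)
  fin_cases i <;> simp <;> fun_prop

/-- **The slope cocycle**: `slope (M^E(α) v) = 1/((E-α) - slope v)` off the vertical axis.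
[folklore] -/
theorem slope_andersonTransfer_apply (E α : ℝ) {v : EuclideanSpace ℝ (Fin 2)} (hv : v 0 ≠ 0) :
    slope (Matrix.toEuclideanLin (andersonTransfer E α) v) = mobStep (E - α) (slope v) := by
  obtain ⟨h0, h1⟩ := andersonTransfer_toEuclideanLin_apply E α v
  unfold slope mobStep
  rw [h0, h1]
  have : E - α - v 1 / v 0 = ((E - α) * v 0 - v 1) / v 0 := by field_simp
  rw [this, inv_div]

/-- **The norm cocycle**: `‖M^E(α) v‖² = J_{E-α}(slope v) ‖v‖²` off the vertical axis. [folklore] -/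
theorem norm_sq_andersonTransfer_apply (E α : ℝ) {v : EuclideanSpace ℝ (Fin 2)} (hv : v 0 ≠ 0) :
    ‖Matrix.toEuclideanLin (andersonTransfer E α) v‖ ^ 2 = stepJac (E - α) (slope v) * ‖v‖ ^ 2 := by
  obtain ⟨h0, h1⟩ := andersonTransfer_toEuclideanLin_apply E α v
  have nsq : ∀ u : EuclideanSpace ℝ (Fin 2), ‖u‖ ^ 2 = u 0 ^ 2 + u 1 ^ 2 := fun u => by
    rw [EuclideanSpace.norm_sq_eq]; simp [Fin.sum_univ_two]
  rw [nsq, nsq, h0, h1]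
  unfold stepJac slope
  have hv2 : v 0 ^ 2 + v 1 ^ 2 ≠ 0 := by positivity
  field_simp

/-- Log form of the norm cocycle: `log ‖M^E(α) v‖ - log ‖v‖ = ½ log J_{E-α}(slope v)`. [folklore] -/
theorem log_norm_andersonTransfer_apply_sub (E α : ℝ) {v : EuclideanSpace ℝ (Fin 2)} (hv : v 0 ≠ 0) :
    Real.log ‖Matrix.toEuclideanLin (andersonTransfer E α) v‖ - Real.log ‖v‖ =
      (1 / 2) * Real.log (stepJac (E - α) (slope v)) := by
  have hvn : 0 < ‖v‖ := by
    rw [norm_pos_iff]; intro h; apply hv; rw [h]; rfl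
  have hJ := stepJac_pos (E - α) (slope v)
  have hsq := norm_sq_andersonTransfer_apply E α hv
  have hAv : 0 < ‖Matrix.toEuclideanLin (andersonTransfer E α) v‖ := by
    have h2 : 0 < ‖Matrix.toEuclideanLin (andersonTransfer E α) v‖ ^ 2 := by rw [hsq]; positivity
    have h3 := norm_nonneg (Matrix.toEuclideanLin (andersonTransfer E α) v)
    rcases h3.lt_or_eq with h | h
    · exact h
    · rw [← h] at h2; norm_num at h2
  have key : Real.log (‖Matrix.toEuclideanLin (andersonTransfer E α) v‖ ^ 2) =
      Real.log (stepJac (E - α) (slope v) * ‖v‖ ^ 2) := by rw [hsq]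
  rw [Real.log_pow, Real.log_mul hJ.ne' (by positivity), Real.log_pow] at key
  push_cast at key
  linarith

/-- Off a single slope, `(M (1,s))₀ ≠ 0` for a unimodular `M`: the exceptional set of the chart
is null for the Cauchy measure. [folklore] -/
theorem ae_apply_baseVec_fst_ne_zero (M : Matrix (Fin 2) (Fin 2) ℝ) (hM : M.det = 1) :
    ∀ᵐ s ∂(cauchyMeasure 0 1), (Matrix.toEuclideanLin M (baseVec s)) 0 ≠ 0 := by
  filter_upwards [ae_cauchy_ne (-M 0 0 / M 0 1)] with s hs
  rw [toEuclideanLin_apply_two, baseVec_zero, baseVec_one, mul_one]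
  intro h
  rw [Matrix.det_fin_two] at hM
  by_cases h01 : M 0 1 = 0
  · rw [h01, zero_mul, add_zero] at h
    rw [h, h01] at hM
    simp at hM
  · apply hs
    field_simp
    linarith

/-- `slope` is measurable. [folklore] -/
theorem measurable_slope : Measurable slope := by
  unfold slope
  have h : ∀ i : Fin 2, Measurable fun v : EuclideanSpace ℝ (Fin 2) => v i := fun i =>
    (continuous_apply i).measurable.comp (PiLp.continuous_ofLp 2 _).measurable
  exact (h 1).div (h 0)

/-- **The chain of vectors** `V_k(x, s) = M_k^E(x) (1, s)ᵀ` driven by the finite sample `x`.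
[folklore] -/
def chainVec (E : ℝ) {n : ℕ} (x : Fin n → ℝ) (k : ℕ) (s : ℝ) : EuclideanSpace ℝ (Fin 2) :=
  Matrix.toEuclideanLin (andersonTransferProd E (padSeq x) k) (baseVec s)

/-- `V_0(x, s) = (1, s)`. [folklore] -/
theorem chainVec_zero (E : ℝ) {n : ℕ} (x : Fin n → ℝ) (s : ℝ) : chainVec E x 0 s = baseVec s := by
  unfold chainVec
  apply PiLp.ext
  intro i
  rw [toEuclideanLin_apply_two]
  fin_cases i <;> simp [andersonTransferProd, Matrix.one_apply]

/-- Joint continuity of `(x, s) ↦ V_k(x, s)`. [folklore] -/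
theorem continuous_chainVec (E : ℝ) (n k : ℕ) :
    Continuous fun p : (Fin n → ℝ) × ℝ => chainVec E p.1 k p.2 := by
  unfold chainVec
  have hM := continuous_andersonTransferProd E (n := n) k
  have h1 : ∀ i j, Continuous fun p : (Fin n → ℝ) × ℝ => andersonTransferProd E (padSeq p.1) k i j :=
    fun i j => ((continuous_apply j).comp ((continuous_apply i).comp hM)).comp continuous_fst
  have hb : ∀ j, Continuous fun p : (Fin n → ℝ) × ℝ => baseVec p.2 j := fun j =>
    ((continuous_apply j).comp ((PiLp.continuous_ofLp 2 _).comp continuous_baseVec)).comp continuous_snd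
  have hcoord : ∀ i, Continuous fun p : (Fin n → ℝ) × ℝ =>
      (Matrix.toEuclideanLin (andersonTransferProd E (padSeq p.1) k) (baseVec p.2)) i := by
    intro i
    simp_rw [toEuclideanLin_apply_two]
    exact ((h1 i 0).mul (hb 0)).add ((h1 i 1).mul (hb 1))
  have : (fun p : (Fin n → ℝ) × ℝ => Matrix.toEuclideanLin (andersonTransferProd E (padSeq p.1) k) (baseVec p.2)) =
      fun p => WithLp.toLp 2 (fun i => (Matrix.toEuclideanLin (andersonTransferProd E (padSeq p.1) k)
        (baseVec p.2)) i) := by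
    funext p; rfl
  rw [this]
  exact (PiLp.continuous_toLp 2 _).comp (continuous_pi hcoord)

/-- Joint measurability of the slope of the chain. [folklore] -/
theorem measurable_slope_chainVec (E : ℝ) (n k : ℕ) :
    Measurable fun p : (Fin n → ℝ) × ℝ => slope (chainVec E p.1 k p.2) :=
  measurable_slope.comp (continuous_chainVec E n k).measurable

/-- **Appending one site**: `V_{n+1}(x ⧺ a, s) = M^E(a) V_n(x, s)`. [folklore] -/
theorem chainVec_append_succ (E : ℝ) {n : ℕ} (x : Fin n → ℝ) (a s : ℝ) :
    chainVec E (Fin.append x (fun _ : Fin 1 => a)) (n + 1) s =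
      Matrix.toEuclideanLin (andersonTransfer E a) (chainVec E x n s) := by
  unfold chainVec
  rw [andersonTransferProd_append E x (fun _ : Fin 1 => a), toEuclideanLin_mul_apply]
  congr 2
  rw [andersonTransferProd_succ, padSeq_of_lt _ Nat.one_pos]
  simp [andersonTransferProd]

/-- **Integrating out the last site**: `∫ H dμ^{⊗(n+1)} = ∫∫ H(x ⧺ a) dμ(a) dμ^{⊗n}(x)`. [folklore] -/
theorem integral_pi_succ_eq_integral_integral (μ : Measure ℝ) [IsProbabilityMeasure μ] (n : ℕ)
    {H : (Fin (n + 1) → ℝ) → ℝ} (hH : Measurable H) (hHi : Integrable H (Measure.pi fun _ : Fin (n + 1) => μ)) :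
    ∫ z, H z ∂(Measure.pi fun _ : Fin (n + 1) => μ) =
      ∫ x, ∫ a, H (Fin.append x (fun _ : Fin 1 => a)) ∂μ ∂(Measure.pi fun _ : Fin n => μ) := by
  rw [integral_pi_fin_add_eq_integral_prod μ n 1 hH]
  have hI : Integrable (fun w : (Fin n → ℝ) × (Fin 1 → ℝ) => H (Fin.append w.1 w.2))
      ((Measure.pi fun _ : Fin n => μ).prod (Measure.pi fun _ : Fin 1 => μ)) :=
    ((measurePreserving_finAppend μ n 1).integrable_comp hH.aestronglyMeasurable).mpr hHi
  rw [integral_prod _ hI]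
  refine integral_congr_ae (Eventually.of_forall fun x => ?_)
  have hmp := measurePreserving_funUnique μ (Fin 1)
  have heq : ∀ y : Fin 1 → ℝ, H (Fin.append x y) =
      H (Fin.append x (fun _ : Fin 1 => (MeasurableEquiv.funUnique (Fin 1) ℝ) y)) := by
    intro y
    congr 2
    funext i
    rw [MeasurableEquiv.funUnique_apply]
    congr 1
    exact Subsingleton.elim _ _
  have hre : ∫ y, H (Fin.append x y) ∂(Measure.pi fun _ : Fin 1 => μ) =
      ∫ y, (fun a => H (Fin.append x (fun _ : Fin 1 => a))) ((MeasurableEquiv.funUnique (Fin 1) ℝ) y)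
        ∂(Measure.pi fun _ : Fin 1 => μ) := integral_congr_ae (Eventually.of_forall heq)
  show ∫ y, H (Fin.append x y) ∂(Measure.pi fun _ : Fin 1 => μ) = ∫ a, H (Fin.append x fun _ => a) ∂μ
  rw [hre]
  exact hmp.integral_comp' (fun a => H (Fin.append x (fun _ : Fin 1 => a)))

/-! ### The iterated densities and the law of the slope chain -/

section Chain

variable {μ : Measure ℝ} {E D : ℝ}

/-- `φ_k` is measurable. [folklore] -/
theorem measurable_iterDensity [SFinite μ] : ∀ k, Measurable (iterDensity μ E k)
  | 0 => measurable_const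
  | k + 1 => measurable_transferOp (measurable_iterDensity k)

/-- `0 ≤ φ_k`. [folklore] -/
theorem iterDensity_nonneg : ∀ k y, 0 ≤ iterDensity μ E k y
  | 0, _ => zero_le_one
  | k + 1, y => transferOp_nonneg (iterDensity_nonneg k) y

/-- `φ_k ≤ D^k`. [folklore] -/
theorem iterDensity_le [IsProbabilityMeasure μ] (hD : ∀ᵐ α ∂μ, (E - α) ^ 2 + 2 ≤ D) :
    ∀ k y, iterDensity μ E k y ≤ D ^ k
  | 0, _ => by simp [iterDensity]
  | k + 1, y => by
    rw [pow_succ]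
    exact transferOp_le hD (iterDensity_nonneg k) (iterDensity_le hD k) y

/-- `0 < φ_k`. [folklore] -/
theorem iterDensity_pos [IsProbabilityMeasure μ] (hD : ∀ᵐ α ∂μ, (E - α) ^ 2 + 2 ≤ D) :
    ∀ k y, 0 < iterDensity μ E k y
  | 0, _ => zero_lt_one
  | k + 1, y => transferOp_pos hD (measurable_iterDensity k) (iterDensity_pos hD k) (iterDensity_le hD k) y

/-- `∫ φ_k dm = 1`. [folklore] -/
theorem integral_iterDensity [IsProbabilityMeasure μ] (hD : ∀ᵐ α ∂μ, (E - α) ^ 2 + 2 ≤ D) :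
    ∀ k, ∫ y, iterDensity μ E k y ∂(cauchyMeasure 0 1) = 1
  | 0 => by simp [iterDensity]
  | k + 1 => by
    show ∫ y, transferOp μ E (iterDensity μ E k) y ∂(cauchyMeasure 0 1) = 1
    rw [integral_transferOp hD (measurable_iterDensity k) (iterDensity_nonneg k) (iterDensity_le hD k),
      integral_iterDensity hD k]

/-- Joint measurability of the Möbius step. [folklore] -/
theorem measurable_mobStep_uncurry : Measurable fun q : ℝ × ℝ => mobStep q.1 q.2 := by
  unfold mobStep; exact (measurable_fst.sub measurable_snd).inv

/-- A bounded integrand has a bounded Cauchy integral. [folklore] -/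
theorem abs_integral_cauchy_le {f : ℝ → ℝ} {G₀ : ℝ} (hf : ∀ s, |f s| ≤ G₀) :
    |∫ s, f s ∂(cauchyMeasure 0 1)| ≤ G₀ := by
  have hG : 0 ≤ G₀ := (abs_nonneg _).trans (hf 0)
  calc |∫ s, f s ∂(cauchyMeasure 0 1)| ≤ ∫ s, |f s| ∂(cauchyMeasure 0 1) := abs_integral_le_integral_abs
    _ ≤ ∫ _s, G₀ ∂(cauchyMeasure 0 1) :=
        integral_mono_of_nonneg (Eventually.of_forall fun s => abs_nonneg _) (integrable_const _)
          (Eventually.of_forall hf)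
    _ = G₀ := by simp

/-- **The law of the slope chain**: for a bounded measurable test function `g`,
`𝔼 ∫ g(slope V_n(x, s)) dm(s) = ∫ g φ_n dm` — started from the Cauchy law, the slope of
`M_n^E (1, s)ᵀ` has density `φ_n = P^n 1` (Markov property of the projective action, proved by
peeling off the last site, the change of variables and Fubini). [folklore] -/
theorem integral_integral_slope_chainVec [IsProbabilityMeasure μ] (hD : ∀ᵐ α ∂μ, (E - α) ^ 2 + 2 ≤ D) :
    ∀ (n : ℕ) (g : ℝ → ℝ), Measurable g → (∃ G₀, ∀ y, |g y| ≤ G₀) →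
      ∫ x, ∫ s, g (slope (chainVec E x n s)) ∂(cauchyMeasure 0 1) ∂(Measure.pi fun _ : Fin n => μ) =
        ∫ y, g y * iterDensity μ E n y ∂(cauchyMeasure 0 1)
  | 0, g, _, _ => by
    simp only [chainVec_zero, slope_baseVec, iterDensity, mul_one]
    rw [integral_const]; simp
  | n + 1, g, hg, ⟨G₀, hG⟩ => by
    -- the integrand after n+1 sites, as a function of the sample
    have hjoint : Measurable fun p : (Fin (n + 1) → ℝ) × ℝ => g (slope (chainVec E p.1 (n + 1) p.2)) :=
      hg.comp (measurable_slope_chainVec E (n + 1) (n + 1))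
    have hHm : Measurable fun z : Fin (n + 1) → ℝ => ∫ s, g (slope (chainVec E z (n + 1) s))
        ∂(cauchyMeasure 0 1) :=
      (hjoint.stronglyMeasurable.integral_prod_right' (ν := cauchyMeasure 0 1)).measurable
    have hHi : Integrable (fun z : Fin (n + 1) → ℝ => ∫ s, g (slope (chainVec E z (n + 1) s))
        ∂(cauchyMeasure 0 1)) (Measure.pi fun _ : Fin (n + 1) => μ) :=
      Integrable.of_bound hHm.aestronglyMeasurable G₀ (Eventually.of_forall fun z => by
        rw [Real.norm_eq_abs]; exact abs_integral_cauchy_le fun s => hG _)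
    rw [integral_pi_succ_eq_integral_integral μ n hHm hHi]
    -- the slope cocycle, a.e. in s
    have hcoc : ∀ (x : Fin n → ℝ) (a : ℝ),
        ∫ s, g (slope (chainVec E (Fin.append x fun _ : Fin 1 => a) (n + 1) s)) ∂(cauchyMeasure 0 1) =
          ∫ s, g (mobStep (E - a) (slope (chainVec E x n s))) ∂(cauchyMeasure 0 1) := by
      intro x a
      refine integral_congr_ae ?_
      filter_upwards [ae_apply_baseVec_fst_ne_zero _ (det_andersonTransferProd E (padSeq x) n)] with s hs
      rw [chainVec_append_succ, slope_andersonTransfer_apply E a (v := chainVec E x n s) hs]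
    simp_rw [hcoc]
    -- swap the sample and the last site
    have hK3 : Measurable fun p : (Fin n → ℝ) × ℝ =>
        ∫ s, g (mobStep (E - p.2) (slope (chainVec E p.1 n s))) ∂(cauchyMeasure 0 1) := by
      have : Measurable fun q : ((Fin n → ℝ) × ℝ) × ℝ =>
          g (mobStep (E - q.1.2) (slope (chainVec E q.1.1 n q.2))) :=
        hg.comp (measurable_mobStep_uncurry.comp ((measurable_const.sub (measurable_snd.comp measurable_fst)).prodMk
          ((measurable_slope_chainVec E n n).comp ((measurable_fst.comp measurable_fst).prodMk measurable_snd))))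
      exact (this.stronglyMeasurable.integral_prod_right' (ν := cauchyMeasure 0 1)).measurable
    have hI3 : Integrable (fun p : (Fin n → ℝ) × ℝ =>
        ∫ s, g (mobStep (E - p.2) (slope (chainVec E p.1 n s))) ∂(cauchyMeasure 0 1))
        ((Measure.pi fun _ : Fin n => μ).prod μ) :=
      Integrable.of_bound hK3.aestronglyMeasurable G₀ (Eventually.of_forall fun p => by
        rw [Real.norm_eq_abs]; exact abs_integral_cauchy_le fun s => hG _)
    rw [integral_integral_swap (f := fun (x : Fin n → ℝ) (a : ℝ) =>
      ∫ s, g (mobStep (E - a) (slope (chainVec E x n s))) ∂(cauchyMeasure 0 1)) hI3]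
    -- induction hypothesis for the shifted test function, then the change of variables
    have hIH : ∀ a, ∫ x, ∫ s, g (mobStep (E - a) (slope (chainVec E x n s))) ∂(cauchyMeasure 0 1)
        ∂(Measure.pi fun _ : Fin n => μ) =
          ∫ y, g y * pushDensity (E - a) (iterDensity μ E n) y ∂(cauchyMeasure 0 1) := by
      intro a
      rw [integral_integral_slope_chainVec hD n (fun y => g (mobStep (E - a) y))
        (hg.comp (measurable_mobStep_uncurry.comp ((measurable_const (a := E - a)).prodMk measurable_id)))
        ⟨G₀, fun y => hG _⟩]
      exact integral_mobStep_cauchy (E - a) g (iterDensity μ E n)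
    simp_rw [hIH]
    -- Fubini in (a, y)
    have hI4 : Integrable (fun p : ℝ × ℝ => g p.2 * pushDensity (E - p.1) (iterDensity μ E n) p.2)
        (μ.prod (cauchyMeasure 0 1)) :=
      (integrable_prod_pushDensity hD (measurable_iterDensity n) (iterDensity_nonneg n)
        (iterDensity_le hD n)).bdd_mul (hg.comp measurable_snd).aestronglyMeasurable
        (Eventually.of_forall fun p => by rw [Real.norm_eq_abs]; exact hG _) (c := G₀)
    rw [integral_integral_swap (f := fun (a y : ℝ) => g y * pushDensity (E - a) (iterDensity μ E n) y) hI4]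
    refine integral_congr_ae (Eventually.of_forall fun y => ?_)
    show ∫ a, g y * pushDensity (E - a) (iterDensity μ E n) y ∂μ = g y * iterDensity μ E (n + 1) y
    rw [integral_const_mul]
    rfl

/-- `|t| ≤ t² + 1`. [folklore] -/
theorem abs_le_sq_add_one (t : ℝ) : |t| ≤ t ^ 2 + 1 := by
  rcases le_or_gt 0 t with h | h
  · rw [abs_of_nonneg h]; nlinarith [sq_nonneg (t - 1)]
  · rw [abs_of_neg h]; nlinarith [sq_nonneg (t + 1)]

/-- Coordinates of an i.i.d. sample inherit an a.s. property of the single-site law. [folklore] -/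
theorem ae_pi_forall [IsProbabilityMeasure μ] {P : ℝ → Prop} (hP : MeasurableSet {a | P a})
    (h : ∀ᵐ a ∂μ, P a) (n : ℕ) :
    ∀ᵐ x ∂(Measure.pi fun _ : Fin n => μ), ∀ i, P (x i) := by
  rw [ae_all_iff]
  intro i
  have hmap : ∀ᵐ a ∂(Measure.map (Function.eval i) (Measure.pi fun _ : Fin n => μ)), P a := by
    rw [(measurePreserving_eval (fun _ : Fin n => μ) i).map_eq]; exact h
  exact (ae_map_iff (measurable_pi_apply i).aemeasurable hP).mp hmap

/-- `‖(1, s)‖ > 0`. [folklore] -/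
theorem norm_baseVec_pos (s : ℝ) : 0 < ‖baseVec s‖ := by
  have nsq : ∀ u : EuclideanSpace ℝ (Fin 2), ‖u‖ ^ 2 = u 0 ^ 2 + u 1 ^ 2 := fun u => by
    rw [EuclideanSpace.norm_sq_eq]; simp [Fin.sum_univ_two]
  have : 0 < ‖baseVec s‖ ^ 2 := by rw [nsq, baseVec_zero, baseVec_one]; positivity
  have h3 := norm_nonneg (baseVec s)
  rcases h3.lt_or_eq with h | h
  · exact h
  · rw [← h] at this; norm_num at this

/-- **Two-sided growth of the chain in logarithmic form**: on the box `|E - x_k| ≤ D₀`,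
`|log ‖V_n(x,s)‖ - log ‖(1,s)‖| ≤ n log (D₀ + 1)`. [folklore] -/
theorem abs_log_norm_chainVec_sub_le (E : ℝ) {D₀ : ℝ} (hD₀ : 0 ≤ D₀) {n m : ℕ} (x : Fin m → ℝ)
    (hx : ∀ k, k < n → |E - padSeq x k| ≤ D₀) (s : ℝ) :
    |Real.log ‖chainVec E x n s‖ - Real.log ‖baseVec s‖| ≤ n * Real.log (D₀ + 1) := by
  obtain ⟨h1, h2⟩ := norm_andersonTransferProd_apply_bounds E hD₀ (padSeq x) (baseVec s) n hx
  have h1' : ‖chainVec E x n s‖ ≤ (D₀ + 1) ^ n * ‖baseVec s‖ := h1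
  have h2' : ‖baseVec s‖ ≤ (D₀ + 1) ^ n * ‖chainVec E x n s‖ := h2
  clear h1 h2
  have hv := norm_baseVec_pos s
  have hpow : 0 < (D₀ + 1) ^ n := by positivity
  have hV : 0 < ‖chainVec E x n s‖ := by
    by_contra hle
    rw [not_lt] at hle
    have := le_antisymm hle (norm_nonneg _)
    rw [this, mul_zero] at h2'
    linarith
  have hl1 := Real.log_le_log hV h1'
  have hl2 := Real.log_le_log hv h2'
  rw [Real.log_mul hpow.ne' hv.ne', Real.log_pow] at hl1
  rw [Real.log_mul hpow.ne' hV.ne', Real.log_pow] at hl2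
  rw [abs_le]
  constructor <;> linarith

/-- Joint measurability of the log-growth of the chain. [folklore] -/
theorem measurable_log_norm_chainVec_sub (E : ℝ) (n k : ℕ) :
    Measurable fun p : (Fin n → ℝ) × ℝ => Real.log ‖chainVec E p.1 k p.2‖ - Real.log ‖baseVec p.2‖ :=
  (continuous_chainVec E n k).norm.measurable.log.sub
    ((continuous_baseVec.comp continuous_snd).norm.measurable.log)

/-- **The mean log-growth along the chain** (the cocycle summed step by step):
`𝔼 ∫ (log ‖V_n(x,s)‖ - log ‖(1,s)‖) dm(s) = ½ Σ_{k<n} ∫∫ log J_{E-α}(y) φ_k(y) dm dμ`.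
[folklore] -/
theorem integral_log_norm_chainVec [IsProbabilityMeasure μ] (hD : ∀ᵐ α ∂μ, (E - α) ^ 2 + 2 ≤ D)
    (hD1 : 1 ≤ D) :
    ∀ n : ℕ, ∫ x, ∫ s, (Real.log ‖chainVec E x n s‖ - Real.log ‖baseVec s‖) ∂(cauchyMeasure 0 1)
        ∂(Measure.pi fun _ : Fin n => μ) =
      (1 / 2) * ∑ k ∈ Finset.range n, ∫ a, ∫ y, Real.log (stepJac (E - a) y) * iterDensity μ E k y
        ∂(cauchyMeasure 0 1) ∂μ
  | 0 => by simp [chainVec_zero]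
  | n + 1 => by
    have hD0 : 0 ≤ D := zero_le_one.trans hD1
    -- a.e. box for the sample
    have hbox : ∀ m : ℕ, ∀ᵐ z ∂(Measure.pi fun _ : Fin m => μ), ∀ k, k < m → |E - padSeq z k| ≤ D := by
      intro m
      have h := ae_pi_forall (μ := μ) (P := fun a => (E - a) ^ 2 + 2 ≤ D)
        (measurableSet_le (by fun_prop) measurable_const) hD m
      filter_upwards [h] with z hz
      intro k hk
      rw [padSeq_of_lt z hk]
      have := hz ⟨k, hk⟩
      have := abs_le_sq_add_one (E - z ⟨k, hk⟩)
      linarith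
    -- Ψ and its integrability
    set Ψ : (Fin (n + 1) → ℝ) → ℝ := fun z => ∫ s, (Real.log ‖chainVec E z (n + 1) s‖ -
      Real.log ‖baseVec s‖) ∂(cauchyMeasure 0 1) with hΨ
    have hΨm : Measurable Ψ :=
      ((measurable_log_norm_chainVec_sub E (n + 1) (n + 1)).stronglyMeasurable.integral_prod_right'
        (ν := cauchyMeasure 0 1)).measurable
    have hΨi : Integrable Ψ (Measure.pi fun _ : Fin (n + 1) => μ) := by
      refine Integrable.of_bound hΨm.aestronglyMeasurable ((n + 1 : ℕ) * Real.log (D + 1)) ?_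
      filter_upwards [hbox (n + 1)] with z hz
      rw [Real.norm_eq_abs]
      exact abs_integral_cauchy_le fun s => abs_log_norm_chainVec_sub_le E hD0 z hz s
    have step1 := integral_pi_succ_eq_integral_integral μ n hΨm hΨi
    rw [step1]
    -- the pointwise decomposition Ψ(x ⧺ a) = ½ P(x,a) + Q(x)
    set P : (Fin n → ℝ) → ℝ → ℝ := fun x a => ∫ s, Real.log (stepJac (E - a) (slope (chainVec E x n s)))
      ∂(cauchyMeasure 0 1) with hP
    set Q : (Fin n → ℝ) → ℝ := fun x => ∫ s, (Real.log ‖chainVec E x n s‖ - Real.log ‖baseVec s‖)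
      ∂(cauchyMeasure 0 1) with hQ
    have hQi_s : ∀ x : Fin n → ℝ, Integrable (fun s => Real.log ‖chainVec E x n s‖ - Real.log ‖baseVec s‖)
        (cauchyMeasure 0 1) := by
      intro x
      have hbd : ∀ k, k < n → |E - padSeq x k| ≤ |E| + ∑ i, |x i| := by
        intro k hk
        rw [padSeq_of_lt x hk]
        have : |x ⟨k, hk⟩| ≤ ∑ i, |x i| :=
          Finset.single_le_sum (f := fun i => |x i|) (fun i _ => abs_nonneg _) (Finset.mem_univ _)
        exact (abs_sub _ _).trans (by linarith)
      have hpos : 0 ≤ |E| + ∑ i, |x i| := by positivity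
      have hpair : Measurable (fun s : ℝ => ((x, s) : (Fin n → ℝ) × ℝ)) := measurable_const.prodMk measurable_id
      have hms := (measurable_log_norm_chainVec_sub E n n).comp hpair
      exact integrable_cauchy_of_bound hms (n * Real.log (|E| + ∑ i, |x i| + 1))
        (abs_log_norm_chainVec_sub_le E hpos x hbd)
    have hPi_s : ∀ (x : Fin n → ℝ) (a : ℝ), Integrable (fun s => Real.log (stepJac (E - a)
        (slope (chainVec E x n s)))) (cauchyMeasure 0 1) := fun x a => by
      have hpair : Measurable (fun s : ℝ => ((x, s) : (Fin n → ℝ) × ℝ)) := measurable_const.prodMk measurable_id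
      have hsl := (measurable_slope_chainVec E n n).comp hpair
      have hms := (measurable_stepJac_uncurry.comp ((measurable_const (a := E - a)).prodMk hsl)).log
      exact integrable_cauchy_of_bound hms (Real.log ((E - a) ^ 2 + 2)) (fun s => abs_log_stepJac_le (E - a) _)
    have hdec : ∀ (x : Fin n → ℝ) (a : ℝ), Ψ (Fin.append x fun _ : Fin 1 => a) = (1 / 2) * P x a + Q x := by
      intro x a
      simp only [hΨ, hP, hQ]
      rw [← integral_const_mul, ← integral_add ((hPi_s x a).const_mul _) (hQi_s x)]
      refine integral_congr_ae ?_
      filter_upwards [ae_apply_baseVec_fst_ne_zero _ (det_andersonTransferProd E (padSeq x) n)] with s hs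
      rw [chainVec_append_succ]
      have := log_norm_andersonTransfer_apply_sub E a (v := chainVec E x n s) hs
      linarith
    simp_rw [hdec]
    -- integrate the decomposition: first in a, then in x
    have hPm : Measurable fun p : (Fin n → ℝ) × ℝ => P p.1 p.2 := by
      have : Measurable fun q : ((Fin n → ℝ) × ℝ) × ℝ =>
          Real.log (stepJac (E - q.1.2) (slope (chainVec E q.1.1 n q.2))) :=
        (measurable_stepJac_uncurry.comp ((measurable_const.sub (measurable_snd.comp measurable_fst)).prodMk
          ((measurable_slope_chainVec E n n).comp ((measurable_fst.comp measurable_fst).prodMk measurable_snd)))).log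
      exact (this.stronglyMeasurable.integral_prod_right' (ν := cauchyMeasure 0 1)).measurable
    have hPbd : ∀ x, ∀ᵐ a ∂μ, |P x a| ≤ Real.log D := by
      intro x
      filter_upwards [hD] with a ha
      refine (abs_integral_cauchy_le fun s => abs_log_stepJac_le (E - a) _).trans ?_
      exact Real.log_le_log (by positivity) ha
    have hPi_a : ∀ x, Integrable (P x) μ := fun x => by
      have hpair : Measurable (fun a : ℝ => ((x, a) : (Fin n → ℝ) × ℝ)) := measurable_const.prodMk measurable_id
      have hms := hPm.comp hpair
      exact Integrable.of_bound hms.aestronglyMeasurable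
        (Real.log D) ((hPbd x).mono fun a ha => by rw [Real.norm_eq_abs]; exact ha)
    have hinner : ∀ x, ∫ a, ((1 / 2) * P x a + Q x) ∂μ = (1 / 2) * ∫ a, P x a ∂μ + Q x := by
      intro x
      have e1 : ∫ a, ((1 / 2) * P x a + Q x) ∂μ = (∫ a, (1 / 2) * P x a ∂μ) + ∫ _a, Q x ∂μ :=
        integral_add ((hPi_a x).const_mul _) (integrable_const _)
      rw [e1, integral_const_mul, integral_const, probReal_univ, one_smul]
    simp_rw [hinner]
    -- integrability in x of both pieces
    have hPI : Integrable (fun p : (Fin n → ℝ) × ℝ => P p.1 p.2) ((Measure.pi fun _ : Fin n => μ).prod μ) := by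
      refine Integrable.of_bound hPm.aestronglyMeasurable (Real.log D) ?_
      have : ∀ᵐ p ∂((Measure.pi fun _ : Fin n => μ).prod μ), (E - p.2) ^ 2 + 2 ≤ D :=
        (Measure.quasiMeasurePreserving_snd (μ := Measure.pi fun _ : Fin n => μ) (ν := μ)).ae hD
      filter_upwards [this] with p hp
      rw [Real.norm_eq_abs]
      refine (abs_integral_cauchy_le fun s => abs_log_stepJac_le (E - p.2) _).trans ?_
      exact Real.log_le_log (by positivity) hp
    have hintP : Integrable (fun x => ∫ a, P x a ∂μ) (Measure.pi fun _ : Fin n => μ) := hPI.integral_prod_left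
    have hQm : Measurable Q :=
      ((measurable_log_norm_chainVec_sub E n n).stronglyMeasurable.integral_prod_right'
        (ν := cauchyMeasure 0 1)).measurable
    have hQI : Integrable Q (Measure.pi fun _ : Fin n => μ) := by
      refine Integrable.of_bound hQm.aestronglyMeasurable ((n : ℕ) * Real.log (D + 1)) ?_
      filter_upwards [hbox n] with z hz
      rw [Real.norm_eq_abs]
      exact abs_integral_cauchy_le fun s => abs_log_norm_chainVec_sub_le E hD0 z hz s
    have e2 : ∫ x, ((1 / 2) * ∫ a, P x a ∂μ + Q x) ∂(Measure.pi fun _ : Fin n => μ) =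
        (∫ x, (1 / 2) * ∫ a, P x a ∂μ ∂(Measure.pi fun _ : Fin n => μ)) +
          ∫ x, Q x ∂(Measure.pi fun _ : Fin n => μ) := integral_add (hintP.const_mul _) hQI
    rw [e2, integral_const_mul]
    -- the Q term is the induction hypothesis
    have hIH := integral_log_norm_chainVec hD hD1 n
    rw [show (∫ x, Q x ∂(Measure.pi fun _ : Fin n => μ)) = _ from hIH]
    -- the P term: swap and apply the law of the slope chain
    rw [integral_integral_swap (f := P) hPI]
    have hpush : ∀ a, ∫ x, P x a ∂(Measure.pi fun _ : Fin n => μ) =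
        ∫ y, Real.log (stepJac (E - a) y) * iterDensity μ E n y ∂(cauchyMeasure 0 1) := fun a =>
      integral_integral_slope_chainVec hD n (fun y => Real.log (stepJac (E - a) y))
        ((measurable_stepJac_uncurry.comp ((measurable_const (a := E - a)).prodMk measurable_id)).log)
        ⟨Real.log ((E - a) ^ 2 + 2), fun y => abs_log_stepJac_le (E - a) y⟩
    simp_rw [hpush]
    rw [Finset.sum_range_succ]
    ring

end Chain

/-! ### Tails of the iterated densities -/

section Tails

variable {μ : Measure ℝ} {E D K : ℝ}

/-- An indicator times a function is the indicator of the function. [folklore] -/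
theorem indicator_one_mul {S : Set ℝ} (f : ℝ → ℝ) (s : ℝ) :
    S.indicator (fun _ => (1 : ℝ)) s * f s = S.indicator f s := by
  by_cases hs : s ∈ S <;> simp [hs]

/-- **Cauchy tails**: `m{|s| > L} ≤ 1/L`. [folklore] -/
theorem integral_indicator_tail_cauchy_le {L : ℝ} (hL : 0 < L) :
    ∫ s, Set.indicator {s | L < |s|} (fun _ => (1 : ℝ)) s * (1 : ℝ) ∂(cauchyMeasure 0 1) ≤ 1 / L := by
  simp_rw [mul_one]
  rw [integral_cauchyMeasure]
  have hc := integrable_cauchyPDFReal 0 (γ := 1)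
  have hind : ∀ S : Set ℝ, MeasurableSet S → Integrable (fun s => S.indicator (fun _ => (1 : ℝ)) s *
      cauchyPDFReal 0 1 s) := by
    intro S hS
    simp_rw [indicator_one_mul]
    exact hc.indicator hS
  have hmeas : MeasurableSet {s : ℝ | L < |s|} := measurableSet_lt measurable_const continuous_abs.measurable
  have hpt : ∀ s, Set.indicator {s | L < |s|} (fun _ => (1 : ℝ)) s * cauchyPDFReal 0 1 s ≤
      Set.indicator (Set.Ioi L) (fun _ => (1 : ℝ)) s * cauchyPDFReal 0 1 s +
        Set.indicator (Set.Iic (-L)) (fun _ => (1 : ℝ)) s * cauchyPDFReal 0 1 s := by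
    intro s
    have hcs := (cauchyPDFReal_zero_one_pos s).le
    by_cases h : L < |s|
    · rcases lt_abs.mp h with h1 | h1
      · have : s ∈ Set.Ioi L := h1
        simp only [Set.indicator_apply, Set.mem_setOf_eq, h, if_true, this, one_mul, Set.mem_Iic]
        split_ifs <;> nlinarith
      · have : s ∈ Set.Iic (-L) := by simp only [Set.mem_Iic]; linarith
        simp only [Set.indicator_apply, Set.mem_setOf_eq, h, if_true, this, one_mul, Set.mem_Ioi]
        split_ifs <;> nlinarith
    · simp only [Set.indicator_apply, Set.mem_setOf_eq, h, if_false, zero_mul]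
      positivity
  have hIoi : ∫ s, Set.indicator (Set.Ioi L) (fun _ => (1 : ℝ)) s * cauchyPDFReal 0 1 s =
      Real.pi⁻¹ * (Real.pi / 2 - Real.arctan L) := by
    simp_rw [indicator_one_mul]
    rw [integral_indicator measurableSet_Ioi]
    simp_rw [cauchyPDFReal_zero_one]
    rw [integral_const_mul, integral_Ioi_inv_one_add_sq]
  have hIic : ∫ s, Set.indicator (Set.Iic (-L)) (fun _ => (1 : ℝ)) s * cauchyPDFReal 0 1 s =
      Real.pi⁻¹ * (Real.pi / 2 - Real.arctan L) := by
    simp_rw [indicator_one_mul]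
    rw [integral_indicator measurableSet_Iic]
    simp_rw [cauchyPDFReal_zero_one]
    rw [integral_const_mul, integral_Iic_inv_one_add_sq, Real.arctan_neg]
    ring
  have harc : Real.pi / 2 - Real.arctan L ≤ L⁻¹ := by
    rw [← Real.arctan_inv_of_pos hL]
    have h1 : 0 ≤ Real.arctan L⁻¹ := Real.arctan_nonneg.mpr (by positivity)
    have h2 := Real.le_tan h1 (Real.arctan_lt_pi_div_two _)
    rwa [Real.tan_arctan] at h2
  have hpi := Real.two_le_pi
  have hpi0 := Real.pi_pos
  calc ∫ s, Set.indicator {s | L < |s|} (fun _ => (1 : ℝ)) s * cauchyPDFReal 0 1 s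
      ≤ ∫ s, (Set.indicator (Set.Ioi L) (fun _ => (1 : ℝ)) s * cauchyPDFReal 0 1 s +
          Set.indicator (Set.Iic (-L)) (fun _ => (1 : ℝ)) s * cauchyPDFReal 0 1 s) :=
        integral_mono (hind _ hmeas) ((hind _ measurableSet_Ioi).add (hind _ measurableSet_Iic)) hpt
    _ = 2 * (Real.pi⁻¹ * (Real.pi / 2 - Real.arctan L)) := by
        rw [integral_add (hind _ measurableSet_Ioi) (hind _ measurableSet_Iic), hIoi, hIic]; ring
    _ ≤ 2 * (Real.pi⁻¹ * L⁻¹) := by gcongr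
    _ ≤ 1 / L := by
        rw [div_eq_mul_inv, one_mul]
        have : Real.pi⁻¹ ≤ 1 / 2 := by rw [inv_eq_one_div, div_le_div_iff₀ hpi0 two_pos]; linarith
        nlinarith [inv_pos.mpr hL]

/-- **Tails after a step**: `∫ 1_{|y|>L} (Pφ)(y) dm(y) ≤ 2K/L` — the slope after a step is large
only if the potential falls within `1/L` of the current slope. [folklore] -/
theorem integral_indicator_tail_transferOp_le [IsProbabilityMeasure μ]
    (hK : ∀ p q : ℝ, μ (Set.Icc p q) ≤ ENNReal.ofReal (K * (q - p))) (hK0 : 0 ≤ K)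
    (hD : ∀ᵐ α ∂μ, (E - α) ^ 2 + 2 ≤ D) {φ : ℝ → ℝ} {B : ℝ}
    (hφ : Measurable φ) (hφ0 : ∀ s, 0 ≤ φ s) (hφB : ∀ s, φ s ≤ B)
    (hφ1 : ∫ s, φ s ∂(cauchyMeasure 0 1) = 1) {L : ℝ} (hL : 0 < L) :
    ∫ y, Set.indicator {y | L < |y|} (fun _ => (1 : ℝ)) y * transferOp μ E φ y ∂(cauchyMeasure 0 1) ≤
      2 * K / L := by
  have hmeasL : Measurable (Set.indicator {y : ℝ | L < |y|} (fun _ => (1 : ℝ))) :=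
    measurable_const.indicator (measurableSet_lt measurable_const continuous_abs.measurable)
  have hind1 : ∀ y, |Set.indicator {y : ℝ | L < |y|} (fun _ => (1 : ℝ)) y| ≤ 1 := fun y => by
    simp only [Set.indicator_apply]; split_ifs <;> simp
  -- Step 1: Fubini in (α, y)
  have hI1 : Integrable (fun p : ℝ × ℝ => Set.indicator {y | L < |y|} (fun _ => (1 : ℝ)) p.2 *
      pushDensity (E - p.1) φ p.2) (μ.prod (cauchyMeasure 0 1)) :=
    (integrable_prod_pushDensity hD hφ hφ0 hφB).bdd_mul (hmeasL.comp measurable_snd).aestronglyMeasurable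
      (Eventually.of_forall fun p => by rw [Real.norm_eq_abs]; exact hind1 _) (c := 1)
  have e1 : ∫ y, Set.indicator {y | L < |y|} (fun _ => (1 : ℝ)) y * transferOp μ E φ y ∂(cauchyMeasure 0 1) =
      ∫ α, ∫ y, Set.indicator {y | L < |y|} (fun _ => (1 : ℝ)) y * pushDensity (E - α) φ y
        ∂(cauchyMeasure 0 1) ∂μ := by
    unfold transferOp
    simp_rw [← integral_const_mul]
    exact integral_integral_swap (f := fun y α => Set.indicator {y | L < |y|} (fun _ => (1 : ℝ)) y *
      pushDensity (E - α) φ y) hI1.swap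
  rw [e1]
  -- Step 2: change of variables backwards and the pointwise inclusion
  have e2 : ∀ α, ∫ y, Set.indicator {y | L < |y|} (fun _ => (1 : ℝ)) y * pushDensity (E - α) φ y
      ∂(cauchyMeasure 0 1) = ∫ s, Set.indicator {y | L < |y|} (fun _ => (1 : ℝ)) (mobStep (E - α) s) * φ s
        ∂(cauchyMeasure 0 1) := fun α =>
    (integral_mobStep_cauchy (E - α) (Set.indicator {y | L < |y|} (fun _ => (1 : ℝ))) φ).symm
  simp_rw [e2]
  have hpt : ∀ α s, Set.indicator {y | L < |y|} (fun _ => (1 : ℝ)) (mobStep (E - α) s) * φ s ≤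
      Set.indicator {s | |E - α - s| < L⁻¹} (fun _ => (1 : ℝ)) s * φ s := by
    intro α s
    by_cases h : L < |mobStep (E - α) s|
    · have h' : |E - α - s| < L⁻¹ := by
        unfold mobStep at h
        rw [abs_inv] at h
        have hne : |E - α - s| ≠ 0 := by
          intro h0; rw [h0, inv_zero] at h; linarith
        have hpos : 0 < |E - α - s| := (abs_nonneg _).lt_of_ne (Ne.symm hne)
        exact (lt_inv_comm₀ hL hpos).mp h
      simp [h, h']
    · simp only [Set.indicator_apply, Set.mem_setOf_eq, h, if_false, zero_mul]
      exact mul_nonneg (Set.indicator_nonneg (fun _ _ => zero_le_one) _) (hφ0 s)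
  -- Step 3: integrate the inclusion; Fubini again
  have hmeas2 : Measurable fun p : ℝ × ℝ => Set.indicator {s | |E - p.1 - s| < L⁻¹} (fun _ => (1 : ℝ)) p.2 * φ p.2 := by
    have hS : MeasurableSet {p : ℝ × ℝ | |E - p.1 - p.2| < L⁻¹} :=
      measurableSet_lt (continuous_abs.measurable.comp ((measurable_const.sub measurable_fst).sub measurable_snd))
        measurable_const
    have : (fun p : ℝ × ℝ => Set.indicator {s | |E - p.1 - s| < L⁻¹} (fun _ => (1 : ℝ)) p.2 * φ p.2) =
        fun p => Set.indicator {p : ℝ × ℝ | |E - p.1 - p.2| < L⁻¹} (fun _ => (1 : ℝ)) p * φ p.2 := by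
      funext p
      simp only [Set.indicator_apply, Set.mem_setOf_eq]
    rw [this]
    exact (measurable_const.indicator hS).mul (hφ.comp measurable_snd)
  have hφi : Integrable φ (cauchyMeasure 0 1) :=
    integrable_cauchy_of_bound hφ B fun s => by rw [abs_of_nonneg (hφ0 s)]; exact hφB s
  have hI2 : Integrable (fun p : ℝ × ℝ => Set.indicator {s | |E - p.1 - s| < L⁻¹} (fun _ => (1 : ℝ)) p.2 * φ p.2)
      (μ.prod (cauchyMeasure 0 1)) := by
    refine Integrable.of_bound hmeas2.aestronglyMeasurable B (Eventually.of_forall fun p => ?_)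
    rw [Real.norm_eq_abs, abs_mul, abs_of_nonneg (hφ0 _)]
    refine (mul_le_of_le_one_left (hφ0 _) ?_).trans (hφB _)
    simp only [Set.indicator_apply]; split_ifs <;> simp
  have hmob1 : ∀ α, Integrable (fun s => Set.indicator {y | L < |y|} (fun _ => (1 : ℝ)) (mobStep (E - α) s) * φ s)
      (cauchyMeasure 0 1) := fun α =>
    hφi.bdd_mul (hmeasL.comp (measurable_mobStep_uncurry.comp
      ((measurable_const (a := E - α)).prodMk measurable_id))).aestronglyMeasurable
      (Eventually.of_forall fun s => by rw [Real.norm_eq_abs]; exact hind1 _) (c := 1)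
  have hI2a : ∀ α, Integrable (fun s => Set.indicator {s | |E - α - s| < L⁻¹} (fun _ => (1 : ℝ)) s * φ s)
      (cauchyMeasure 0 1) := fun α =>
    hφi.bdd_mul (measurable_const.indicator (measurableSet_lt (continuous_abs.measurable.comp
      (measurable_const.sub measurable_id)) measurable_const)).aestronglyMeasurable
      (Eventually.of_forall fun s => by
        rw [Real.norm_eq_abs]; simp only [Set.indicator_apply]; split_ifs <;> simp) (c := 1)
  have step3 : ∀ α, ∫ s, Set.indicator {y | L < |y|} (fun _ => (1 : ℝ)) (mobStep (E - α) s) * φ s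
      ∂(cauchyMeasure 0 1) ≤ ∫ s, Set.indicator {s | |E - α - s| < L⁻¹} (fun _ => (1 : ℝ)) s * φ s
        ∂(cauchyMeasure 0 1) := fun α => integral_mono (hmob1 α) (hI2a α) (hpt α)
  have step4 : ∫ α, ∫ s, Set.indicator {y | L < |y|} (fun _ => (1 : ℝ)) (mobStep (E - α) s) * φ s
      ∂(cauchyMeasure 0 1) ∂μ ≤ ∫ α, ∫ s, Set.indicator {s | |E - α - s| < L⁻¹} (fun _ => (1 : ℝ)) s * φ s
        ∂(cauchyMeasure 0 1) ∂μ :=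
    integral_mono_of_nonneg (Eventually.of_forall fun α => integral_nonneg fun s =>
      mul_nonneg (Set.indicator_nonneg (fun _ _ => zero_le_one) _) (hφ0 s)) hI2.integral_prod_left
      (Eventually.of_forall step3)
  refine step4.trans ?_
  rw [integral_integral_swap (f := fun α s => Set.indicator {s | |E - α - s| < L⁻¹} (fun _ => (1 : ℝ)) s * φ s) hI2]
  -- Step 4: the inner α-integral is φ(s) μ{α : |E - α - s| < 1/L} ≤ φ(s) 2K/L
  have hS : ∀ s, MeasurableSet {α : ℝ | |E - α - s| < L⁻¹} := fun s =>
    measurableSet_lt (continuous_abs.measurable.comp ((measurable_const.sub measurable_id).sub measurable_const))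
      measurable_const
  have hinner : ∀ s, ∫ α, Set.indicator {s | |E - α - s| < L⁻¹} (fun _ => (1 : ℝ)) s * φ s ∂μ ≤
      2 * K / L * φ s := by
    intro s
    have e : ∫ α, Set.indicator {s | |E - α - s| < L⁻¹} (fun _ => (1 : ℝ)) s * φ s ∂μ =
        μ.real {α : ℝ | |E - α - s| < L⁻¹} * φ s := by
      have : (fun α => Set.indicator {s | |E - α - s| < L⁻¹} (fun _ => (1 : ℝ)) s * φ s) =
          fun α => Set.indicator {α : ℝ | |E - α - s| < L⁻¹} (fun _ => (1 : ℝ)) α * φ s := by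
        funext α; simp only [Set.indicator_apply, Set.mem_setOf_eq]
      rw [this, integral_mul_const, integral_indicator (hS s), setIntegral_const, smul_eq_mul, mul_one]
    rw [e]
    refine mul_le_mul_of_nonneg_right ?_ (hφ0 s)
    have hsub : {α : ℝ | |E - α - s| < L⁻¹} ⊆ Set.Icc (E - s - L⁻¹) (E - s + L⁻¹) := by
      intro α hα
      simp only [Set.mem_setOf_eq, abs_lt] at hα
      constructor <;> linarith [hα.1, hα.2]
    have h1 : μ {α : ℝ | |E - α - s| < L⁻¹} ≤ ENNReal.ofReal (K * (2 * L⁻¹)) := by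
      refine (measure_mono hsub).trans ((hK _ _).trans (le_of_eq ?_))
      ring_nf
    rw [measureReal_def]
    refine (ENNReal.toReal_le_of_le_ofReal (by positivity) h1).trans (le_of_eq ?_)
    field_simp
  calc ∫ s, ∫ α, Set.indicator {s | |E - α - s| < L⁻¹} (fun _ => (1 : ℝ)) s * φ s ∂μ ∂(cauchyMeasure 0 1)
      ≤ ∫ s, 2 * K / L * φ s ∂(cauchyMeasure 0 1) :=
        integral_mono_of_nonneg (Eventually.of_forall fun s => integral_nonneg fun α =>
          mul_nonneg (Set.indicator_nonneg (fun _ _ => zero_le_one) _) (hφ0 s)) (hφi.const_mul _)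
          (Eventually.of_forall hinner)
    _ = 2 * K / L := by rw [integral_const_mul, hφ1, mul_one]

end Tails

/-! ### Assembly: positivity of the Lyapunov exponent -/

section Main

variable {μ : Measure ℝ} {E D K R : ℝ}

/-- `H(φ) = ∫ φ log φ dm ≥ 0` for a probability density `φ` (from `t log t ≥ t - 1`). [folklore] -/
theorem integral_mul_log_nonneg {φ : ℝ → ℝ} {B : ℝ} (hφ : Measurable φ) (hφ0 : ∀ s, 0 < φ s)
    (hφB : ∀ s, φ s ≤ B) (hB : 1 ≤ B) (hφ1 : ∫ s, φ s ∂(cauchyMeasure 0 1) = 1) :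
    0 ≤ ∫ s, φ s * Real.log (φ s) ∂(cauchyMeasure 0 1) := by
  have hi1 : Integrable (fun s => φ s * Real.log (φ s)) (cauchyMeasure 0 1) :=
    integrable_cauchy_of_bound (hφ.mul hφ.log) (B * Real.log B + 1) fun s => abs_mul_log_le (hφ0 s) (hφB s) hB
  have hφi : Integrable φ (cauchyMeasure 0 1) :=
    integrable_cauchy_of_bound hφ B fun s => by rw [abs_of_pos (hφ0 s)]; exact hφB s
  have := integral_mono (hφi.sub (integrable_const 1)) hi1 fun s => sub_one_le_mul_log (hφ0 s).le
  have e : ∫ s, (φ s - 1) ∂(cauchyMeasure 0 1) = (∫ s, φ s ∂(cauchyMeasure 0 1)) - ∫ _s, (1 : ℝ) ∂(cauchyMeasure 0 1) :=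
    integral_sub hφi (integrable_const 1)
  have this' : ∫ s, (φ s - 1) ∂(cauchyMeasure 0 1) ≤ ∫ s, φ s * Real.log (φ s) ∂(cauchyMeasure 0 1) := this
  rw [e, hφ1] at this'
  simp at this'
  linarith

/-- **Uniform tails of the iterated densities**: `∫ 1_{|s|>L} φ_k dm ≤ (2K+1)/L`. [folklore] -/
theorem integral_indicator_tail_iterDensity_le [IsProbabilityMeasure μ]
    (hK : ∀ p q : ℝ, μ (Set.Icc p q) ≤ ENNReal.ofReal (K * (q - p))) (hK0 : 0 ≤ K)
    (hD : ∀ᵐ α ∂μ, (E - α) ^ 2 + 2 ≤ D) :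
    ∀ (k : ℕ) (L : ℝ), 0 < L → ∫ s, Set.indicator {s | L < |s|} (fun _ => (1 : ℝ)) s * iterDensity μ E k s
      ∂(cauchyMeasure 0 1) ≤ (2 * K + 1) / L
  | 0, L, hL => by
    refine (integral_indicator_tail_cauchy_le hL).trans ?_
    exact div_le_div_of_nonneg_right (by linarith) hL.le
  | k + 1, L, hL => by
    refine (integral_indicator_tail_transferOp_le hK hK0 hD (measurable_iterDensity k) (iterDensity_nonneg k)
      (iterDensity_le hD k) (integral_iterDensity hD k) hL).trans ?_
    exact div_le_div_of_nonneg_right (by linarith) hL.le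

/-- The chain vector never vanishes. [folklore] -/
theorem norm_chainVec_pos (E : ℝ) {n : ℕ} (x : Fin n → ℝ) (k : ℕ) (s : ℝ) : 0 < ‖chainVec E x k s‖ := by
  have hbd : ∀ j, j < k → |E - padSeq x j| ≤ |E| + ∑ i, |x i| := by
    intro j hj
    by_cases hjn : j < n
    · rw [padSeq_of_lt x hjn]
      have : |x ⟨j, hjn⟩| ≤ ∑ i, |x i| :=
        Finset.single_le_sum (f := fun i => |x i|) (fun i _ => abs_nonneg _) (Finset.mem_univ _)
      exact (abs_sub _ _).trans (by linarith)
    · rw [padSeq_of_le x (not_lt.mp hjn), sub_zero]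
      have : 0 ≤ ∑ i, |x i| := Finset.sum_nonneg fun i _ => abs_nonneg _
      linarith
  have hpos : 0 ≤ |E| + ∑ i, |x i| := by positivity
  obtain ⟨-, h2⟩ := norm_andersonTransferProd_apply_bounds E hpos (padSeq x) (baseVec s) k hbd
  have h2' : ‖baseVec s‖ ≤ (|E| + ∑ i, |x i| + 1) ^ k * ‖chainVec E x k s‖ := h2
  have hv := norm_baseVec_pos s
  by_contra hle
  rw [not_lt] at hle
  have := le_antisymm hle (norm_nonneg _)
  rw [this, mul_zero] at h2'
  linarith

/-- For every sample, `s ↦ log ‖V_n(x,s)‖ - log ‖(1,s)‖` is integrable against the Cauchy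
measure. [folklore] -/
theorem integrable_log_norm_chainVec_sub (E : ℝ) {n : ℕ} (x : Fin n → ℝ) :
    Integrable (fun s => Real.log ‖chainVec E x n s‖ - Real.log ‖baseVec s‖) (cauchyMeasure 0 1) := by
  have hbd : ∀ k, k < n → |E - padSeq x k| ≤ |E| + ∑ i, |x i| := by
    intro k hk
    rw [padSeq_of_lt x hk]
    have : |x ⟨k, hk⟩| ≤ ∑ i, |x i| :=
      Finset.single_le_sum (f := fun i => |x i|) (fun i _ => abs_nonneg _) (Finset.mem_univ _)
    exact (abs_sub _ _).trans (by linarith)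
  have hpos : 0 ≤ |E| + ∑ i, |x i| := by positivity
  have hpair : Measurable (fun s : ℝ => ((x, s) : (Fin n → ℝ) × ℝ)) := measurable_const.prodMk measurable_id
  have hms := (measurable_log_norm_chainVec_sub E n n).comp hpair
  exact integrable_cauchy_of_bound hms (n * Real.log (|E| + ∑ i, |x i| + 1))
    (abs_log_norm_chainVec_sub_le E hpos x hbd)

/-- `∫ (log ‖V_n(x,s)‖ - log ‖(1,s)‖) dm(s) ≤ log ‖M_n(x)‖`. [folklore] -/
theorem integral_log_norm_chainVec_sub_le (E : ℝ) {n : ℕ} (x : Fin n → ℝ) :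
    ∫ s, (Real.log ‖chainVec E x n s‖ - Real.log ‖baseVec s‖) ∂(cauchyMeasure 0 1) ≤
      Real.log ‖andersonTransferProd E (padSeq x) n‖ := by
  have hM : 1 ≤ ‖andersonTransferProd E (padSeq x) n‖ :=
    one_le_norm_of_det_eq_one _ (det_andersonTransferProd E _ n)
  have hpt : ∀ s, Real.log ‖chainVec E x n s‖ - Real.log ‖baseVec s‖ ≤
      Real.log ‖andersonTransferProd E (padSeq x) n‖ := by
    intro s
    have hv := norm_baseVec_pos s
    have hV := norm_chainVec_pos E x n s
    have hle : ‖chainVec E x n s‖ ≤ ‖andersonTransferProd E (padSeq x) n‖ * ‖baseVec s‖ :=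
      norm_toEuclideanLin_apply_le _ _
    have := Real.log_le_log hV hle
    rw [Real.log_mul (by linarith) hv.ne'] at this
    linarith
  calc ∫ s, (Real.log ‖chainVec E x n s‖ - Real.log ‖baseVec s‖) ∂(cauchyMeasure 0 1)
      ≤ ∫ _s, Real.log ‖andersonTransferProd E (padSeq x) n‖ ∂(cauchyMeasure 0 1) :=
        integral_mono (integrable_log_norm_chainVec_sub E x) (integrable_const _) hpt
    _ = Real.log ‖andersonTransferProd E (padSeq x) n‖ := by simp

/-- **The quantitative lower bound on the finite-volume averages**: if the single-site law has
`μ[p,q] ≤ K(q-p)` and bounded support, then `n⁻¹ 𝔼 log ‖M_n^E‖ ≥ r/2` for every `n ≥ 1`, with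
`r = (3/(8(64(2K+1)K+1)))²/8` depending on the density bound `K` only. [folklore] -/
theorem andersonLogNormAvg_ge [IsProbabilityMeasure μ] (hK0 : 0 < K)
    (hK : ∀ p q : ℝ, μ (Set.Icc p q) ≤ ENNReal.ofReal (K * (q - p))) (hR : ∀ᵐ x ∂μ, |x| ≤ R)
    (E : ℝ) {n : ℕ} (hn : 1 ≤ n) :
    (3 / (8 * (64 * (2 * K + 1) * K + 1))) ^ 2 / 8 / 2 ≤ andersonLogNormAvg μ E n := by
  set D := (|E| + R) ^ 2 + 2 with hDdef
  have hD : ∀ᵐ α ∂μ, (E - α) ^ 2 + 2 ≤ D := ae_sq_add_two_le hR E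
  have hD1 : 1 ≤ D := by rw [hDdef]; nlinarith [sq_nonneg (|E| + R)]
  have hD0 : 0 ≤ D := zero_le_one.trans hD1
  set C := 2 * K + 1 with hC
  have hCpos : 0 < C := by rw [hC]; linarith
  set r := (3 / (8 * (64 * C * K + 1))) ^ 2 / 8 with hr
  -- the densities
  have hmeas := fun k => measurable_iterDensity (μ := μ) (E := E) k
  have hposφ := fun k => iterDensity_pos (μ := μ) (E := E) hD k
  have hleφ := fun k => iterDensity_le (μ := μ) (E := E) hD k
  have hmass := fun k => integral_iterDensity (μ := μ) (E := E) hD k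
  have hBk : ∀ k : ℕ, (1 : ℝ) ≤ D ^ k := fun k => one_le_pow₀ hD1
  -- per-step quantities
  set I2 : ℕ → ℝ := fun k => ∫ a, ∫ y, Real.log (stepJac (E - a) y) * iterDensity μ E k y
    ∂(cauchyMeasure 0 1) ∂μ with hI2
  set H : ℕ → ℝ := fun k => ∫ s, iterDensity μ E k s * Real.log (iterDensity μ E k s) ∂(cauchyMeasure 0 1)
    with hH
  set Rk : ℕ → ℝ := fun k => ∫ a, ∫ y, (Real.sqrt (pushDensity (E - a) (iterDensity μ E k) y) -
    Real.sqrt (iterDensity μ E (k + 1) y)) ^ 2 ∂(cauchyMeasure 0 1) ∂μ with hRk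
  have hstep : ∀ k, H (k + 1) - H k + Rk k ≤ I2 k := fun k =>
    entropy_step hD hD1 (hmeas k) (hposφ k) (hleφ k) (hBk k)
  have hRlow : ∀ k, r ≤ Rk k := fun k =>
    hellinger_variance_lower hK hK0 hD (hmeas k) (hposφ k) (hleφ k) (hBk k) (hmass k) hCpos
      (integral_indicator_tail_iterDensity_le hK hK0.le hD k)
  have hH0 : H 0 = 0 := by simp [hH, iterDensity]
  have hHn : 0 ≤ H n := integral_mul_log_nonneg (hmeas n) (hposφ n) (hleφ n) (hBk n) (hmass n)
  -- summation
  have hsum : (n : ℝ) * r ≤ ∑ k ∈ Finset.range n, I2 k := by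
    have h1 : ∑ k ∈ Finset.range n, (H (k + 1) - H k + Rk k) ≤ ∑ k ∈ Finset.range n, I2 k :=
      Finset.sum_le_sum fun k _ => hstep k
    rw [Finset.sum_add_distrib, Finset.sum_range_sub, hH0, sub_zero] at h1
    have h2 : (n : ℝ) * r ≤ ∑ k ∈ Finset.range n, Rk k := by
      have := Finset.sum_le_sum fun k (_ : k ∈ Finset.range n) => hRlow k
      simpa using this
    linarith
  -- the link with the matrix norms
  have hlink := integral_log_norm_chainVec (μ := μ) hD hD1 n
  have hbox : ∀ᵐ z ∂(Measure.pi fun _ : Fin n => μ), ∀ k, k < n → |E - padSeq z k| ≤ D := by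
    have h := ae_pi_forall (μ := μ) (P := fun a => (E - a) ^ 2 + 2 ≤ D)
      (measurableSet_le (by fun_prop) measurable_const) hD n
    filter_upwards [h] with z hz
    intro k hk
    rw [padSeq_of_lt z hk]
    have := hz ⟨k, hk⟩
    have := abs_le_sq_add_one (E - z ⟨k, hk⟩)
    linarith
  have hQm : Measurable fun x : Fin n → ℝ => ∫ s, (Real.log ‖chainVec E x n s‖ - Real.log ‖baseVec s‖)
      ∂(cauchyMeasure 0 1) :=
    ((measurable_log_norm_chainVec_sub E n n).stronglyMeasurable.integral_prod_right'
      (ν := cauchyMeasure 0 1)).measurable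
  have hQI : Integrable (fun x : Fin n → ℝ => ∫ s, (Real.log ‖chainVec E x n s‖ - Real.log ‖baseVec s‖)
      ∂(cauchyMeasure 0 1)) (Measure.pi fun _ : Fin n => μ) := by
    refine Integrable.of_bound hQm.aestronglyMeasurable ((n : ℕ) * Real.log (D + 1)) ?_
    filter_upwards [hbox] with z hz
    rw [Real.norm_eq_abs]
    exact abs_integral_cauchy_le fun s => abs_log_norm_chainVec_sub_le E hD0 z hz s
  have hNm : Measurable fun x : Fin n → ℝ => Real.log ‖andersonTransferProd E (padSeq x) n‖ :=
    (continuous_norm.comp (continuous_andersonTransferProd E n)).measurable.log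
  have hNI : Integrable (fun x : Fin n → ℝ => Real.log ‖andersonTransferProd E (padSeq x) n‖)
      (Measure.pi fun _ : Fin n => μ) := by
    refine Integrable.of_bound hNm.aestronglyMeasurable ((n : ℕ) * Real.log (D + 1)) ?_
    filter_upwards [hbox] with z hz
    have h1 := norm_andersonTransferProd_le E hD0 (padSeq z) n hz
    have h0 := one_le_norm_of_det_eq_one _ (det_andersonTransferProd E (padSeq z) n)
    rw [Real.norm_eq_abs, abs_of_nonneg (Real.log_nonneg h0), ← Real.log_pow]
    exact Real.log_le_log (by linarith) h1
  have hupper : ∫ x, ∫ s, (Real.log ‖chainVec E x n s‖ - Real.log ‖baseVec s‖) ∂(cauchyMeasure 0 1)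
      ∂(Measure.pi fun _ : Fin n => μ) ≤ ∫ x, Real.log ‖andersonTransferProd E (padSeq x) n‖
        ∂(Measure.pi fun _ : Fin n => μ) :=
    integral_mono hQI hNI fun x => integral_log_norm_chainVec_sub_le E x
  -- conclude
  have hn0 : (0 : ℝ) < n := by exact_mod_cast hn
  unfold andersonLogNormAvg
  rw [hlink] at hupper
  have key : (n : ℝ) * r / 2 ≤ ∫ x, Real.log ‖andersonTransferProd E (padSeq x) n‖
      ∂(Measure.pi fun _ : Fin n => μ) := by linarith
  calc (3 / (8 * (64 * (2 * K + 1) * K + 1))) ^ 2 / 8 / 2 = r / 2 := by rw [hr]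
    _ = 1 / (n : ℝ) * ((n : ℝ) * r / 2) := by field_simp
    _ ≤ 1 / (n : ℝ) * ∫ x, Real.log ‖andersonTransferProd E (padSeq x) n‖ ∂(Measure.pi fun _ : Fin n => μ) :=
        mul_le_mul_of_nonneg_left key (by positivity)

/-- **Positivity of the Lyapunov exponent for absolutely continuous single-site laws** (the
conclusion of Fürstenberg's theorem, Bucaj et al. Thm 2.3, in the case of a site law with a
bounded density and bounded support — with an explicit lower bound depending on the density
bound only): `L(E) ≥ (3/(8(64(2K+1)K+1)))²/16 > 0` for every energy `E`. Proof: Fürstenberg's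
entropy argument made quantitative — entropy production against the Cauchy reference measure
(`entropy_step`), uniform non-invariance of tight densities under the shears
`A(a')⁻¹A(a) = [[1,0],[a'-a,1]]` (`hellinger_variance_lower`), and the law of the slope chain
(`integral_integral_slope_chainVec`, `integral_log_norm_chainVec`).
[cite: BucajEtAl2019, Thm 2.3] -/
theorem andersonLyapunov_pos_of_density [IsProbabilityMeasure μ] (hK0 : 0 < K)
    (hK : ∀ p q : ℝ, μ (Set.Icc p q) ≤ ENNReal.ofReal (K * (q - p))) (hR : ∀ᵐ x ∂μ, |x| ≤ R)
    (E : ℝ) : 0 < andersonLyapunov μ E := by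
  have hr : 0 < (3 / (8 * (64 * (2 * K + 1) * K + 1))) ^ 2 / 8 / 2 := by positivity
  refine hr.trans_le (le_ciInf fun n => ?_)
  exact andersonLogNormAvg_ge hK0 hK hR E (Nat.succ_le_succ (Nat.zero_le n))

end Main

end Literature.Probability.RandomMatrixProducts
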